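import Literature.Barriers.FinalStateConjecture.ExtremalHorizonSphereSobolev
import Literature.Geometry.Lorentzian.KerrStarWaveOperator
import Literature.Geometry.Lorentzian.KerrCarterCommutation
import Literature.Geometry.Lorentzian.KerrRedShiftBulk
import HarnessLib

/-!
# Barrier catalogue `FinalStateConjecture`: the Carter operator step of Aretakis 2012 on the
# extremal Kerr–Schild chart, and the reduction of `Aretakis2012_pointwiseDecay` to `L²(S_τ)` decay
# (`Literature/Barriers/FinalStateConjecture/`, D-0021, D-0014; family `gr`)

The named fact `Aretakis2012_pointwiseDecay` (`ExtremalHorizonAxisymmetricDecay.lean`; Aretakis,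
JFA 263 (2012), Thm. 5, second clause, in the consequence form `sup_{S_τ}|ψ| → 0` on the horizon
spheres of extremal Kerr for axisymmetric solutions) was reduced in `ExtremalHorizonSphereSobolev.lean`
(`Aretakis2012_pointwiseDecay_of_sphereDecay`) to the decay of the two sphere integrals
`∫∫ sin θ ψ(p_τ)²` and `∫∫ sin θ (Δ̸ψ)(τ)²`. In the printed proof (§15, Lemma 15.0.1) the second is
controlled by the first applied to the solutions `Qψ` and `T²ψ`, `Q` being the **Carter operator**:
"since `[Q, □_g] = 0`, `Qψ` is also a solution" (§5.3) and `Qψ = Δ̸ψ + a² sin² θ TTψ` on axisymmetric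
functions. **This file carries out that step** for the prelude's extremal Kerr metric and the class of
solutions of the fact, using the coordinate form of `ρ²□_g` (`KerrStarWaveOperator.lean`) and the
commutation of its radial and angular parts (`KerrCarterCommutation.lean`), and proves the resulting
**reduction of the named fact to `L²(S_τ)` decay alone**:

* `Kerr.radOpChart M a Φ` — **the radial Carter operator on the chart**,
  `𝓡Φ = Δ ∂_ρ∂_ρΦ + Δ' ∂_ρΦ + 4Mr ∂_ρTΦ + 2M TΦ − (r² + a² + 2Mr) TTΦ` with `∂_ρ = (0, ℓ⃗) = ℓ♯ + ∂₀`
  (`Kerr.radialVec`, `Kerr.rDeriv`, `Kerr.tDeriv`): smooth where `Φ` is (`r > 0`), axisymmetry on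
  `{r > 0}` preserved (`Kerr.radOpChart_axialRotation`), and along the Kerr-star chart equal to the
  radial part `𝓡(Φ ∘ κ)` of `ρ²□_g` (`Kerr.radOp_starPull`); on axisymmetric solutions `𝓡Φ = −QΦ`;
* `Kerr.dalembertian_radOpChart_eq_zero` (**`Qψ` is again a solution**): for `Φ` of class `C^∞` on an
  open `U₀` of the chart, axisymmetric on `{r > 0}`, with `□_{g_{M,M}}Φ = 0` on `U₀`, also
  `□_{g_{M,M}}(𝓡Φ) = 0` on `U₀` — off the axis through the separated equations `𝓡G + 𝓐G = 0`,
  `𝓡(𝓡G) + 𝓐(𝓡G) = 0` for `G = Φ ∘ κ` (`Kerr.separated_equations_starPull`,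
  `Kerr.StarCoord.separated_radOp`; `∂_φG = 0` by `Kerr.starFrame_three_eq_axialVector`), on the axis
  by continuity of the coordinate wave expression (`Kerr.coordWave`);
* `Kerr.radOpChart_localised`: localised data stay localised (the jets of a localised solution vanish
  to order three at the far points of the initial leaf: `Kerr.fderiv_fderiv_eq_zero_of_localised`,
  `Kerr.fderiv_fderiv_fderiv_eq_zero_of_localised`, from the wave equation and `timeDeriv_localised`);
* `Kerr.roundLap_eq_neg_radOpChart` (**`Δ̸ψ = −𝓡ψ − M² sin² θ TTψ` on the horizon spheres**, off the
  poles, for smooth axisymmetric solutions: the separated equation at the coordinate point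
  `(σ, M, θ, φ)` of `p_σ(θ, φ)`, `Kerr.starChart_horizonCoord`) and
  `Kerr.sphereIntegral_roundLap_sq_le`: `∫∫ sin θ (Δ̸ψ)² ≤ 2∫∫ sin θ (𝓡ψ)² + 2M⁴ ∫∫ sin θ (TTψ)²`;
* `Aretakis2012_pointwiseDecay_of_sphereL2Decay` (**the reduction**): if for every `Φ` of class
  `C^∞` on an open `U₀ ⊇ {r ≥ M} ∩ {t* ≥ 0}` of `Kerr.region M r₀` (`0 < r₀ < M`), axisymmetric on
  `{r > 0}`, solving `□_{g_{M,M}}Φ = 0` on `U₀` and with Cauchy data on `{t* = 0}` supported in a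
  coordinate ball, the sphere integrals `∫₀^{2π}∫₀^π sin θ Φ(p_τ(θ, φ))² dθ dφ` tend to `0`, then
  `Aretakis2012_pointwiseDecay` holds.

What remains of the printed proof below this file (not proved here; no named facts introduced,
D-0026): the `L²(S_τ)` decay itself, i.e. §15.2.2 of the source — Theorems 1–3 (integrated local
energy decay §§8–12, uniform boundedness of the `N`-energy §13, decay of the degenerate energy §14)
feeding the hypotheses (A), (B), (F) of `Kerr.horizonSphereSq_decay_of_shellEnergy`
(`ExtremalHorizonSphereDecay.lean`).

## References

* S. Aretakis, *Decay of axisymmetric solutions of the wave equation on extreme Kerr backgrounds*,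
  J. Funct. Anal. 263 (2012) 2770–2831 (arXiv:1110.2006): §2.4–2.5 (coordinates, `T, Y, Φ`, `∂_ρ`),
  §5.3 (the Carter operator, `[Q, □_g] = 0`), Thm. 5 and §15 (Lemma 15.0.1, §15.2.2)
  (key `Aretakis2012`).
* S. Aretakis, *Horizon instability of extremal black holes*, Adv. Theor. Math. Phys. 19 (2015),
  §2.2, §5.2 (the spheres `S_τ`, the frame on `𝓗⁺`) (key `Aretakis2015`).
* B. O'Neill, *The geometry of Kerr black holes*, 1995, Ch. 2, §2.2 (the axial Killing field)
  (key `ONeill1995`).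
* R. P. Kerr, A. Schild, 1965, §2 (key `KerrSchild1965`); M. Visser, arXiv:0706.0622, §4
  (key `arXiv07060622`).
-/

noncomputable section

open Set Filter MeasureTheory intervalIntegral
open scoped Topology ContDiff Manifold

namespace Literature.Barriers.FinalStateConjecture.Kerr

open Literature.Geometry.Lorentzian

/-! ### Vanishing of the higher jets of a localised solution at the far points of the initial leaf -/

section Jets

/-- **Tangential derivatives vanish where a function vanishes on the leaf.** If `F` (with values in
a normed space) is differentiable at `x`, `x⁰ = 0`, `‖x⃗‖ > ρ`, and `F = 0` at all points `y` of an
open set `O ∋ x` with `y⁰ = 0` and `‖y⃗‖ > ρ`, then `DF(x) w = 0` for every `w` tangent to the leaf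
(`w⁰ = 0`). [folklore] -/
theorem fderiv_tangential_eq_zero_of_vanish {F' : Type*} [NormedAddCommGroup F'] [NormedSpace ℝ F']
    {F : E4 → F'} {x : E4} (hF : DifferentiableAt ℝ F x) {O : Set E4} (hO : IsOpen O) (hxO : x ∈ O)
    (hx0 : x 0 = 0) {ρ : ℝ} (hxρ : ρ < E4.spatialNorm x)
    (hvan : ∀ y ∈ O, y 0 = 0 → ρ < E4.spatialNorm y → F y = 0) {w : E4} (hw : w 0 = 0) :
    fderiv ℝ F x w = 0 := by
  have h1 : HasLineDerivAt ℝ F (fderiv ℝ F x w) x w := hF.hasFDerivAt.hasLineDerivAt _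
  have h2 : HasLineDerivAt ℝ F 0 x w := by
    have hg : Continuous fun t : ℝ ↦ x + t • w := continuous_const.add (continuous_id.smul continuous_const)
    have hev1 : ∀ᶠ t : ℝ in 𝓝 0, x + t • w ∈ O := by
      refine hg.continuousAt.eventually_mem ?_
      rw [zero_smul, add_zero]
      exact hO.mem_nhds hxO
    have hev2 : ∀ᶠ t : ℝ in 𝓝 0, ρ < E4.spatialNorm (x + t • w) := by
      have hc : Continuous fun t : ℝ ↦ E4.spatialNorm (x + t • w) :=
        (continuous_norm.comp E4.spatial.continuous).comp hg
      have ht : Tendsto (fun t : ℝ ↦ E4.spatialNorm (x + t • w)) (𝓝 0) (𝓝 (E4.spatialNorm x)) := by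
        have h := hc.continuousAt (x := 0)
        rwa [ContinuousAt, show E4.spatialNorm (x + (0 : ℝ) • w) = E4.spatialNorm x by
          rw [zero_smul, add_zero]] at h
      exact ht.eventually_const_lt hxρ
    have hev : (fun t : ℝ ↦ F (x + t • w)) =ᶠ[𝓝 0] fun _ ↦ (0 : F') := by
      filter_upwards [hev1, hev2] with t ht1 ht2
      have ht0 : (x + t • w) 0 = 0 := by
        rw [PiLp.add_apply, PiLp.smul_apply, smul_eq_mul, hx0, hw, mul_zero, add_zero]
      exact hvan _ ht1 ht0 ht2
    show HasDerivAt (fun t : ℝ ↦ F (x + t • w)) 0 0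
    exact (hasDerivAt_const (0 : ℝ) (0 : F')).congr_of_eventuallyEq hev
  exact h1.unique h2

variable [Kerr.Facts] [Kerr.SliceFacts] {M r₀ : ℝ} {Φ : E4 → ℝ} {U₀ : Set (Kerr.region M r₀)} {ρ : ℝ}

/-- **The second jet of a localised solution vanishes at the far points of the initial leaf.** Let
`Φ` be smooth on `E4`, solve `□_{g_{M,M}} = 0` as a chart function on the open `U₀`, and vanish with
`DΦ` at the points of `U₀ ∩ {t* = 0}` with `‖x⃗‖ > ρ`. Then `D²Φ = 0` at these points: the
tangential slots by differentiation along the leaf (`fderiv_fderiv_tangential_eq_zero`), the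
component `D²Φ(∂₀, ∂₀)` by the wave equation (`g^{00} = −1 − 2H ≠ 0` for `M ≥ 0`), as in
`timeDeriv_localised`. [folklore] -/
theorem fderiv_fderiv_eq_zero_of_localised (hM : 0 ≤ M) (hΦ : ContDiff ℝ ∞ Φ) (hU₀ : IsOpen U₀)
    (hsol : ∀ x ∈ U₀, (Kerr.smoothMetric M M r₀).toPseudoRiemannianMetric.dalembertian
      (fun y : Kerr.region M r₀ ↦ Φ y) x = 0)
    (hloc : ∀ x ∈ U₀, (x : E4) 0 = 0 → ρ < E4.spatialNorm (x : E4) → Φ x = 0 ∧ fderiv ℝ Φ x = 0)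
    (x : Kerr.region M r₀) (hx : x ∈ U₀) (hx0 : (x : E4) 0 = 0) (hxρ : ρ < E4.spatialNorm (x : E4)) :
    fderiv ℝ (fderiv ℝ Φ) x = 0 := by
  set O : Set E4 := Subtype.val '' U₀ with hOdef
  have hO : IsOpen O := (Kerr.region M r₀).isOpen.isOpenMap_subtype_val U₀ hU₀
  have hxO : (x : E4) ∈ O := ⟨x, hx, rfl⟩
  have hlocO : ∀ y ∈ O, y 0 = 0 → ρ < E4.spatialNorm y → fderiv ℝ Φ y = 0 := by
    rintro _ ⟨y, hyU, rfl⟩ hy0 hyρ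
    exact (hloc y hyU hy0 hyρ).2
  have htan : ∀ w : E4, w 0 = 0 → ∀ u, fderiv ℝ (fderiv ℝ Φ) x w u = 0 := fun w hw u ↦
    fderiv_fderiv_tangential_eq_zero (hΦ.contDiffAt.of_le (WithTop.coe_le_coe.mpr le_top)) hO hxO hx0
      hxρ hlocO hw u
  have hsym : ∀ v w, fderiv ℝ (fderiv ℝ Φ) x v w = fderiv ℝ (fderiv ℝ Φ) x w v := fun v w ↦
    (hΦ.contDiffAt.isSymmSndFDerivAt minSmoothness_two_le_infty) v w
  have hb : ∀ μ : Fin 4, μ ≠ 0 → (E4.basisVector μ) 0 = 0 := fun μ hμ ↦ by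
    rw [basisVector_apply, if_neg hμ.symm]
  have hz1 : ∀ μ : Fin 4, μ ≠ 0 → ∀ ν, fderiv ℝ (fderiv ℝ Φ) x (E4.basisVector μ) (E4.basisVector ν) = 0 :=
    fun μ hμ ν ↦ htan _ (hb μ hμ) _
  have hz2 : ∀ ν : Fin 4, ν ≠ 0 → fderiv ℝ (fderiv ℝ Φ) x (E4.basisVector 0) (E4.basisVector ν) = 0 :=
    fun ν hν ↦ by rw [hsym, hz1 ν hν]
  -- `∂²_{t*} Φ (x) = 0` from the wave equation
  have h00 : fderiv ℝ (fderiv ℝ Φ) x (E4.basisVector 0) (E4.basisVector 0) = 0 := by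
    have h := hsol x hx
    rw [dalembertian_eq_hessian_add_firstOrder M M r₀ (ψ := fun y : Kerr.region M r₀ ↦ Φ y) (Φ := Φ)
      (fun _ ↦ rfl) x (hΦ.contDiffAt.of_le (WithTop.coe_le_coe.mpr le_top)), (hloc x hx hx0 hxρ).2] at h
    simp only [Fin.sum_univ_four, _root_.zero_apply, mul_zero, add_zero, Fin.isValue,
      hz1 1 one_ne_zero, hz1 2 (by decide), hz1 3 (by decide), hz2 1 one_ne_zero, hz2 2 (by decide),
      hz2 3 (by decide)] at h
    have hg : Kerr.inverseMetric M M x 0 0 = -1 - 2 * Kerr.scalarH M M x := by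
      rw [Kerr.inverseMetric_apply, Kerr.nullVector_apply_zero]
      simp
    have hH := Kerr.scalarH_nonneg hM M (x : E4)
    rw [hg] at h
    have hne : (-1 - 2 * Kerr.scalarH M M x) ≠ 0 := by linarith
    exact (mul_eq_zero.mp h).resolve_left hne
  -- all components vanish
  have hall : ∀ μ ν, fderiv ℝ (fderiv ℝ Φ) x (E4.basisVector μ) (E4.basisVector ν) = 0 := by
    intro μ ν
    by_cases hμ : μ = 0
    · subst hμ
      by_cases hν : ν = 0
      · subst hν; exact h00
      · exact hz2 ν hν
    · exact hz1 μ hμ ν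
  ext v w
  rw [bilin_eq_sum_sum (fderiv ℝ (fderiv ℝ Φ) x) v w]
  simp only [hall, mul_zero, Finset.sum_const_zero, _root_.zero_apply]

omit [Kerr.Facts] [Kerr.SliceFacts] in
/-- Slots of the third derivative through the `t*`-derivative:
`D³Φ(x)(u)(v)(∂₀) = D²(TΦ)(x)(u)(v)`, `TΦ = ∂_{t*}Φ`. [folklore] -/
theorem fderiv_fderiv_fderiv_basisVector_zero (hΦ : ContDiff ℝ ∞ Φ) (x u v : E4) :
    fderiv ℝ (fderiv ℝ (fderiv ℝ Φ)) x u v (E4.basisVector 0) =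
      fderiv ℝ (fderiv ℝ (fun y ↦ fderiv ℝ Φ y (E4.basisVector 0))) x u v := by
  have h1 : ContDiff ℝ ∞ (fderiv ℝ Φ) := hΦ.fderiv_right (m := ∞) le_rfl
  have h2 : ContDiff ℝ ∞ (fderiv ℝ (fderiv ℝ Φ)) := h1.fderiv_right (m := ∞) le_rfl
  have hd1 : Differentiable ℝ (fderiv ℝ Φ) := h1.differentiable (WithTop.coe_ne_zero.mpr ENat.top_ne_zero)
  have hd2 : Differentiable ℝ (fderiv ℝ (fderiv ℝ Φ)) := h2.differentiable (WithTop.coe_ne_zero.mpr ENat.top_ne_zero)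
  have hT : ContDiff ℝ ∞ (fun y ↦ fderiv ℝ Φ y (E4.basisVector 0)) := h1.clm_apply contDiff_const
  have hdT : Differentiable ℝ (fderiv ℝ (fun y ↦ fderiv ℝ Φ y (E4.basisVector 0))) :=
    (hT.fderiv_right (m := ∞) le_rfl).differentiable (WithTop.coe_ne_zero.mpr ENat.top_ne_zero)
  -- `D(TΦ)(y) v = D²Φ(y)(v, ∂₀)` at every `y`
  have hfun : (fun y ↦ fderiv ℝ (fun y ↦ fderiv ℝ Φ y (E4.basisVector 0)) y v) =
      fun y ↦ fderiv ℝ (fderiv ℝ Φ) y v (E4.basisVector 0) :=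
    funext fun y ↦ fderiv_clm_apply_const_apply (hd1 y) (E4.basisVector 0) v
  -- left side as a derivative of `y ↦ D²Φ(y)(v, ∂₀)`
  have hc' : DifferentiableAt ℝ (fun y ↦ fderiv ℝ (fderiv ℝ Φ) y v) x :=
    ((hd2 x).hasFDerivAt.clm_apply (hasFDerivAt_const v x)).differentiableAt
  rw [← fderiv_clm_apply_const_apply (hd2 x) v u,
    ← fderiv_clm_apply_const_apply (c := fun y ↦ fderiv ℝ (fderiv ℝ Φ) y v) hc' (E4.basisVector 0) u,
    ← hfun, fderiv_clm_apply_const_apply (hdT x) v u]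

/-- **The third jet of a localised solution vanishes at the far points of the initial leaf**
(from `fderiv_fderiv_eq_zero_of_localised` applied to `Φ` near the point and to `TΦ` at the point,
and the symmetry of third derivatives). [folklore] -/
theorem fderiv_fderiv_fderiv_eq_zero_of_localised (hM : 0 ≤ M) (hΦ : ContDiff ℝ ∞ Φ) (hU₀ : IsOpen U₀)
    (hsol : ∀ x ∈ U₀, (Kerr.smoothMetric M M r₀).toPseudoRiemannianMetric.dalembertian
      (fun y : Kerr.region M r₀ ↦ Φ y) x = 0)
    (hloc : ∀ x ∈ U₀, (x : E4) 0 = 0 → ρ < E4.spatialNorm (x : E4) → Φ x = 0 ∧ fderiv ℝ Φ x = 0)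
    (x : Kerr.region M r₀) (hx : x ∈ U₀) (hx0 : (x : E4) 0 = 0) (hxρ : ρ < E4.spatialNorm (x : E4)) :
    fderiv ℝ (fderiv ℝ (fderiv ℝ Φ)) x = 0 := by
  have h1 : ContDiff ℝ ∞ (fderiv ℝ Φ) := hΦ.fderiv_right (m := ∞) le_rfl
  have h2 : ContDiff ℝ ∞ (fderiv ℝ (fderiv ℝ Φ)) := h1.fderiv_right (m := ∞) le_rfl
  have hd2 : Differentiable ℝ (fderiv ℝ (fderiv ℝ Φ)) := h2.differentiable (WithTop.coe_ne_zero.mpr ENat.top_ne_zero)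
  -- the open set over `U₀` and the vanishing of `D²Φ` on its far leaf part
  set O : Set E4 := Subtype.val '' U₀ with hOdef
  have hO : IsOpen O := (Kerr.region M r₀).isOpen.isOpenMap_subtype_val U₀ hU₀
  have hxO : (x : E4) ∈ O := ⟨x, hx, rfl⟩
  have hvan2 : ∀ y ∈ O, y 0 = 0 → ρ < E4.spatialNorm y → fderiv ℝ (fderiv ℝ Φ) y = 0 := by
    rintro _ ⟨y, hyU, rfl⟩ hy0 hyρ
    exact fderiv_fderiv_eq_zero_of_localised hM hΦ hU₀ hsol hloc y hyU hy0 hyρ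
  -- (a) tangential first slot
  have htan : ∀ w : E4, w 0 = 0 → fderiv ℝ (fderiv ℝ (fderiv ℝ Φ)) x w = 0 := fun w hw ↦
    fderiv_tangential_eq_zero_of_vanish (F := fderiv ℝ (fderiv ℝ Φ)) (hd2 x) hO hxO hx0 hxρ hvan2 hw
  -- (b) last slot `∂₀`: `D²(TΦ)(x) = 0` since `TΦ` is in the class
  have hT : ContDiff ℝ ∞ (fun y ↦ fderiv ℝ Φ y (E4.basisVector 0)) :=
    (hΦ.fderiv_right (m := ∞) le_rfl).clm_apply contDiff_const
  have hsolT := fun y hy ↦ dalembertian_timeDeriv_eq_zero (M := M) (r₀ := r₀) hΦ hU₀ hsol y hy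
  have hlocT : ∀ y ∈ U₀, (y : E4) 0 = 0 → ρ < E4.spatialNorm (y : E4) →
      fderiv ℝ Φ y (E4.basisVector 0) = 0 ∧ fderiv ℝ (fun z ↦ fderiv ℝ Φ z (E4.basisVector 0)) y = 0 :=
    fun y hy hy0 hyρ ↦ timeDeriv_localised hM hΦ hU₀ hsol hloc y hy hy0 hyρ
  have hT2 : fderiv ℝ (fderiv ℝ (fun y ↦ fderiv ℝ Φ y (E4.basisVector 0))) x = 0 :=
    fderiv_fderiv_eq_zero_of_localised hM hT hU₀ hsolT hlocT x hx hx0 hxρ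
  have hlast : ∀ u v, fderiv ℝ (fderiv ℝ (fderiv ℝ Φ)) x u v (E4.basisVector 0) = 0 := by
    intro u v
    rw [fderiv_fderiv_fderiv_basisVector_zero hΦ, hT2]
    rfl
  -- assemble: split the last slot into `w⁰ ∂₀ + (w − w⁰ ∂₀)`
  ext u v w
  have hw : w = (w 0) • E4.basisVector 0 + (w - (w 0) • E4.basisVector 0) := by abel
  have hwt : (w - (w 0) • E4.basisVector 0) 0 = 0 := by
    simp
  rw [hw, map_add, map_smul, hlast, smul_zero, zero_add,
    fderiv_fderiv_fderiv_cyclic hΦ x u v (w - (w 0) • E4.basisVector 0), htan _ hwt]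
  rfl

end Jets

/-! ### The radial Carter operator on the Kerr–Schild chart -/

section RadialOperator

/-- The radial coordinate field `∂_ρ = (0, ℓ⃗) = ℓ♯ + ∂₀` of the Kerr–Schild leaves (`= κ_*∂_r`,
`Kerr.nullVector_starChart`; Aretakis's `∂_ρ` of §2.4–2.5 on `Σ_τ ∩ {r ≥ M}`).
[cite: Aretakis2012, §2.4] -/
def radialVec (a : ℝ) (y : E4) : E4 := Kerr.nullVector a y + E4.basisVector 0

/-- `T Φ = ∂_{t*}Φ` as a function on the chart. [cite: Aretakis2012, §2.4] -/
def tDeriv (Φ : E4 → ℝ) : E4 → ℝ := fun y ↦ fderiv ℝ Φ y (E4.basisVector 0)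

/-- `∂_ρ Φ = DΦ(∂_ρ)` as a function on the chart. [cite: Aretakis2012, §2.4] -/
def rDeriv (a : ℝ) (Φ : E4 → ℝ) : E4 → ℝ := fun y ↦ fderiv ℝ Φ y (radialVec a y)

/-- **The radial Carter operator on the chart** (spin `a`, mass `M`):
`𝓡Φ = Δ(r) ∂_ρ∂_ρΦ + Δ'(r) ∂_ρΦ + 4Mr ∂_ρTΦ + 2M TΦ − (r² + a² + 2Mr) TTΦ`, `r = r(a, y)` the
Kerr–Schild radius, `Δ = r² − 2Mr + a²`. Along the Kerr-star chart `κ` it is the radial part `𝓡` of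
`ρ²□_g` of `KerrCarterCommutation.lean` (`radOpChart_starChart`); on axisymmetric solutions it is
`−Qψ`, `Q` the Carter operator (Aretakis, JFA 263 (2012), §5.3; §8: `ρ²□_g` separates into a radial
part and `Q`). [cite: Aretakis2012, §5.3] -/
def radOpChart (M a : ℝ) (Φ : E4 → ℝ) : E4 → ℝ := fun y ↦
  (Kerr.radius a y ^ 2 - 2 * M * Kerr.radius a y + a ^ 2) * rDeriv a (rDeriv a Φ) y +
    (2 * Kerr.radius a y - 2 * M) * rDeriv a Φ y + 4 * M * Kerr.radius a y * rDeriv a (tDeriv Φ) y +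
    2 * M * tDeriv Φ y - (Kerr.radius a y ^ 2 + a ^ 2 + 2 * M * Kerr.radius a y) * tDeriv (tDeriv Φ) y

variable {a : ℝ}

/-- The radial field is smooth where `r > 0`. [folklore] -/
theorem contDiffAt_radialVec {y : E4} (hy : 0 < Kerr.radius a y) {n : WithTop ℕ∞} :
    ContDiffAt ℝ n (radialVec a) y :=
  (Kerr.contDiffAt_nullVector a hy).add contDiffAt_const

/-- `T` of a function `C^∞` near `y` is `C^∞` near `y`. [folklore] -/
theorem contDiffAt_tDeriv {Φ : E4 → ℝ} {y : E4} (hΦ : ContDiffAt ℝ ∞ Φ y) : ContDiffAt ℝ ∞ (tDeriv Φ) y :=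
  (hΦ.fderiv_right (m := ∞) le_rfl).clm_apply contDiffAt_const

/-- `∂_ρ` of a function `C^∞` near `y` (`r(y) > 0`) is `C^∞` near `y`. [folklore] -/
theorem contDiffAt_rDeriv {Φ : E4 → ℝ} {y : E4} (hy : 0 < Kerr.radius a y) (hΦ : ContDiffAt ℝ ∞ Φ y) :
    ContDiffAt ℝ ∞ (rDeriv a Φ) y :=
  (hΦ.fderiv_right (m := ∞) le_rfl).clm_apply (contDiffAt_radialVec hy)

/-- **The radial Carter operator of a function `C^∞` near `y` (`r(y) > 0`) is `C^∞` near `y`.**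
[folklore] -/
theorem contDiffAt_radOpChart (M : ℝ) {Φ : E4 → ℝ} {y : E4} (hy : 0 < Kerr.radius a y)
    (hΦ : ContDiffAt ℝ ∞ Φ y) : ContDiffAt ℝ ∞ (radOpChart M a Φ) y := by
  have hr : ContDiffAt ℝ ∞ (Kerr.radius a) y := Kerr.contDiffAt_radius hy
  have h1 := contDiffAt_rDeriv hy hΦ
  have h11 := contDiffAt_rDeriv hy h1
  have h0 := contDiffAt_tDeriv hΦ
  have h10 := contDiffAt_rDeriv hy h0
  have h00 := contDiffAt_tDeriv h0
  unfold radOpChart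
  exact (((((((hr.pow 2).sub (contDiffAt_const.mul hr)).add contDiffAt_const).mul h11).add
    (((contDiffAt_const.mul hr).sub contDiffAt_const).mul h1)).add
    ((contDiffAt_const.mul hr).mul h10)).add (contDiffAt_const.mul h0)).sub
    ((((hr.pow 2).add contDiffAt_const).add (contDiffAt_const.mul hr)).mul h00)

/-! ### Axisymmetry on `{r > 0}` is preserved -/

/-- The punctured coordinate space `{r > 0}` (it contains every chart `Kerr.region a r₀`, `r₀ ≥ 0`)
is open. [folklore] -/
theorem isOpen_radius_pos (a : ℝ) : IsOpen {z : E4 | 0 < Kerr.radius a z} :=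
  isOpen_lt continuous_const (Kerr.continuous_radius a)

/-- **Derivatives of a function axisymmetric on `{r > 0}` along rotated vectors**: if
`Φ(R_β z) = Φ(z)` whenever `r(z) > 0` and `Φ` is differentiable at `R_β y`, `r(y) > 0`, then
`DΦ(R_β y)(R_β v) = DΦ(y)(v)`. [cite: ONeill1995, Ch. 2 §2.2] -/
theorem fderiv_axialRotation_apply {Φ : E4 → ℝ}
    (haxi : ∀ β z, 0 < Kerr.radius a z → Φ (E4.axialRotation β z) = Φ z)
    (β : ℝ) {y : E4} (hy : 0 < Kerr.radius a y) (hd : DifferentiableAt ℝ Φ (E4.axialRotation β y)) (v : E4) :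
    fderiv ℝ Φ (E4.axialRotation β y) (E4.axialRotation β v) = fderiv ℝ Φ y v := by
  have hev : Φ =ᶠ[𝓝 y] Φ ∘ E4.axialRotation β := by
    filter_upwards [(isOpen_radius_pos a).mem_nhds hy] with z hz
    exact (haxi β z hz).symm
  rw [hev.fderiv_eq, fderiv_comp y hd (E4.axialRotation β).differentiableAt,
    ContinuousLinearMap.comp_apply, (E4.axialRotation β).fderiv]

/-- The radial field is equivariant: `∂_ρ(R_β y) = R_β ∂_ρ(y)`. [cite: KerrSchild1965, §2] -/
theorem radialVec_axialRotation (a β : ℝ) (y : E4) :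
    radialVec a (E4.axialRotation β y) = E4.axialRotation β (radialVec a y) := by
  simp only [radialVec, Kerr.nullVector_axialRotation, map_add]
  congr 1
  ext i
  fin_cases i <;> simp

/-- `∂₀` is invariant under the rotations. [folklore] -/
theorem axialRotation_basisVector_zero (β : ℝ) : E4.axialRotation β (E4.basisVector 0) = E4.basisVector 0 := by
  ext i
  fin_cases i <;> simp

/-- A function axisymmetric on `{r > 0}` and differentiable there is differentiable at `R_β y`,
`r(y) > 0` (`r` is rotation invariant). [folklore] -/
theorem differentiableAt_axialRotation_of_invariant {Φ : E4 → ℝ}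
    (hd : ∀ z, 0 < Kerr.radius a z → DifferentiableAt ℝ Φ z) (β : ℝ) {y : E4}
    (hy : 0 < Kerr.radius a y) : DifferentiableAt ℝ Φ (E4.axialRotation β y) :=
  hd _ (by rwa [Kerr.radius_axialRotation])

/-- **`T` preserves axisymmetry on `{r > 0}`.** [cite: ONeill1995, Ch. 2 §2.2] -/
theorem tDeriv_axialRotation {Φ : E4 → ℝ} (haxi : ∀ β z, 0 < Kerr.radius a z → Φ (E4.axialRotation β z) = Φ z)
    (hd : ∀ z, 0 < Kerr.radius a z → DifferentiableAt ℝ Φ z) (β : ℝ) {y : E4} (hy : 0 < Kerr.radius a y) :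
    tDeriv Φ (E4.axialRotation β y) = tDeriv Φ y := by
  simp only [tDeriv]
  have h := fderiv_axialRotation_apply haxi β hy (differentiableAt_axialRotation_of_invariant hd β hy)
    (E4.basisVector 0)
  rwa [axialRotation_basisVector_zero] at h

/-- **`∂_ρ` preserves axisymmetry on `{r > 0}`.** [cite: KerrSchild1965, §2] -/
theorem rDeriv_axialRotation {Φ : E4 → ℝ} (haxi : ∀ β z, 0 < Kerr.radius a z → Φ (E4.axialRotation β z) = Φ z)
    (hd : ∀ z, 0 < Kerr.radius a z → DifferentiableAt ℝ Φ z) (β : ℝ) {y : E4} (hy : 0 < Kerr.radius a y) :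
    rDeriv a Φ (E4.axialRotation β y) = rDeriv a Φ y := by
  simp only [rDeriv]
  rw [radialVec_axialRotation, fderiv_axialRotation_apply haxi β hy
    (differentiableAt_axialRotation_of_invariant hd β hy)]

/-- **The radial Carter operator preserves axisymmetry on `{r > 0}`** for functions `C^∞` on
`{r > 0}`. [cite: Aretakis2012, §5.3] -/
theorem radOpChart_axialRotation (M : ℝ) {Φ : E4 → ℝ}
    (haxi : ∀ β z, 0 < Kerr.radius a z → Φ (E4.axialRotation β z) = Φ z)
    (hΦ : ∀ z, 0 < Kerr.radius a z → ContDiffAt ℝ ∞ Φ z) (β : ℝ) {y : E4} (hy : 0 < Kerr.radius a y) :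
    radOpChart M a Φ (E4.axialRotation β y) = radOpChart M a Φ y := by
  -- differentiability on `{r > 0}` of the building blocks
  have hd : ∀ z, 0 < Kerr.radius a z → DifferentiableAt ℝ Φ z := fun z hz ↦ (hΦ z hz).differentiableAt (by simp)
  have hd1 : ∀ z, 0 < Kerr.radius a z → DifferentiableAt ℝ (rDeriv a Φ) z := fun z hz ↦
    (contDiffAt_rDeriv hz (hΦ z hz)).differentiableAt (by simp)
  have hd0 : ∀ z, 0 < Kerr.radius a z → DifferentiableAt ℝ (tDeriv Φ) z := fun z hz ↦
    (contDiffAt_tDeriv (hΦ z hz)).differentiableAt (by simp)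
  -- invariance of the building blocks
  have i1 : ∀ β z, 0 < Kerr.radius a z → rDeriv a Φ (E4.axialRotation β z) = rDeriv a Φ z :=
    fun β z hz ↦ rDeriv_axialRotation haxi hd β hz
  have i0 : ∀ β z, 0 < Kerr.radius a z → tDeriv Φ (E4.axialRotation β z) = tDeriv Φ z :=
    fun β z hz ↦ tDeriv_axialRotation haxi hd β hz
  have i11 := rDeriv_axialRotation (a := a) i1 hd1 β hy
  have i10 := rDeriv_axialRotation (a := a) i0 hd0 β hy
  have i00 := tDeriv_axialRotation (a := a) i0 hd0 β hy
  simp only [radOpChart, Kerr.radius_axialRotation, i11, i10, i00, i1 β y hy, i0 β y hy]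

end RadialOperator

/-! ### The radial Carter operator along the Kerr-star chart -/

section Pullback

open Kerr.StarCoord

variable {M a : ℝ} {Φ : E4 → ℝ} {q : E4}

/-- `κ_*∂_r = ∂_ρ ∘ κ` (`r > 0`). [cite: arXiv07060622, §4] -/
theorem starFrame_one_eq_radialVec (a : ℝ) (hr : 0 < q 1) :
    Kerr.starFrame a q 1 = radialVec a (Kerr.starChart a q) := by
  rw [radialVec, Kerr.nullVector_starChart a hr, sub_add_cancel]

/-- The axial Killing field through the spatial embedding: `Φ_axial(x) = (0, x₁ e₁ − x₂ e₀)`.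
[cite: ONeill1995, Ch. 2 §2.2] -/
theorem axialVector_eq_spaceEmbed (x : E4) :
    Kerr.axialVector x = E4.spaceEmbed ((x 1) • E3.e 1 - (x 2) • E3.e 0) := by
  rw [Kerr.axialVector, map_sub, map_smul, map_smul, Kerr.spaceEmbed_e, Kerr.spaceEmbed_e]
  rfl

/-- **`κ_*∂_φ = Φ_axial ∘ κ`**: the `φ`-coordinate field of the chart is the axial Killing field
`x₁∂₂ − x₂∂₁` (`Kerr.axialVector`). [cite: ONeill1995, Ch. 2 §2.2] -/
theorem starFrame_three_eq_axialVector (a : ℝ) (q : E4) :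
    Kerr.starFrame a q 3 = Kerr.axialVector (Kerr.starChart a q) := by
  have h1 : Kerr.starChart a q 1 = (q 1 * Real.cos (q 3) - a * Real.sin (q 3)) * Real.sin (q 2) := by
    rw [Kerr.starChart_eq_toLp]; rfl
  have h2 : Kerr.starChart a q 2 = (q 1 * Real.sin (q 3) + a * Real.cos (q 3)) * Real.sin (q 2) := by
    rw [Kerr.starChart_eq_toLp]; rfl
  rw [axialVector_eq_spaceEmbed, Kerr.starFrame_three, h1, h2, sphAzimuth_eq, sphHoriz_eq_sum]
  congr 1
  module

/-- `∂₁(Φ ∘ κ) = (∂_ρΦ) ∘ κ` at `q` (`r = q 1 > 0`, `Φ` differentiable at `κ q`). [folklore] -/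
theorem pd_one_starPull (hr : 0 < q 1) (hΦ : DifferentiableAt ℝ Φ (Kerr.starChart a q)) :
    pd 1 (Kerr.starPull a Φ) q = Kerr.starPull a (rDeriv a Φ) q := by
  rw [pd_apply, Kerr.fderiv_starPull hΦ 1, starFrame_one_eq_radialVec a hr]
  rfl

/-- `∂₀(Φ ∘ κ) = (TΦ) ∘ κ` at `q` (`Φ` differentiable at `κ q`). [folklore] -/
theorem pd_zero_starPull (hΦ : DifferentiableAt ℝ Φ (Kerr.starChart a q)) :
    pd 0 (Kerr.starPull a Φ) q = Kerr.starPull a (tDeriv Φ) q := by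
  rw [pd_apply, Kerr.fderiv_starPull hΦ 0, Kerr.starFrame_zero]
  rfl

/-- `∂₃(Φ ∘ κ) = DΦ(Φ_axial) ∘ κ` at `q`. [folklore] -/
theorem pd_three_starPull (hΦ : DifferentiableAt ℝ Φ (Kerr.starChart a q)) :
    pd 3 (Kerr.starPull a Φ) q = fderiv ℝ Φ (Kerr.starChart a q) (Kerr.axialVector (Kerr.starChart a q)) := by
  rw [pd_apply, Kerr.fderiv_starPull hΦ 3, starFrame_three_eq_axialVector]

/-- Near a coordinate point `q` with `r = q 1 > 0` over which `Φ` is `C^∞`, the first-order chain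
rules hold on a neighbourhood: `∂₁(Φ ∘ κ) = (∂_ρΦ) ∘ κ` and `∂₀(Φ ∘ κ) = (TΦ) ∘ κ` eventually.
[folklore] -/
theorem pd_starPull_eventuallyEq (hr : 0 < q 1) (hΦ : ContDiffAt ℝ ∞ Φ (Kerr.starChart a q)) :
    (pd 1 (Kerr.starPull a Φ) =ᶠ[𝓝 q] Kerr.starPull a (rDeriv a Φ)) ∧
      (pd 0 (Kerr.starPull a Φ) =ᶠ[𝓝 q] Kerr.starPull a (tDeriv Φ)) := by
  have hev1 : ∀ᶠ q' in 𝓝 q, 0 < q' 1 :=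
    (isOpen_lt continuous_const (PiLp.continuous_apply 2 _ 1)).mem_nhds hr
  have hΦ1 : ContDiffAt ℝ 1 Φ (Kerr.starChart a q) := hΦ.of_le (by exact_mod_cast le_top)
  have hev2 : ∀ᶠ q' in 𝓝 q, ContDiffAt ℝ 1 Φ (Kerr.starChart a q') :=
    (Kerr.contDiff_starChart a (n := 0)).continuous.continuousAt.eventually
      (hΦ1.eventually (by simp))
  constructor
  · filter_upwards [hev1, hev2] with q' h1 h2
    exact pd_one_starPull h1 (h2.differentiableAt one_ne_zero)
  · filter_upwards [hev2] with q' h2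
    exact pd_zero_starPull (h2.differentiableAt one_ne_zero)

/-- **The radial part of `ρ²□_g` along the chart is the radial Carter operator on the chart**:
`𝓡 (Φ ∘ κ)(q) = (𝓡Φ)(κ q)` for `r = q 1 > 0` and `Φ` of class `C^∞` near `κ q`
(`radOp` of `KerrCarterCommutation.lean` versus `radOpChart`). [cite: Aretakis2012, §2.4 and §5.3] -/
theorem radOp_starPull (M : ℝ) (hr : 0 < q 1) (hΦ : ContDiffAt ℝ ∞ Φ (Kerr.starChart a q)) :
    radOp M a (Kerr.starPull a Φ) q = radOpChart M a Φ (Kerr.starChart a q) := by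
  have hx : 0 < Kerr.radius a (Kerr.starChart a q) := by rw [Kerr.radius_starChart a hr]; exact hr
  have hΦd : DifferentiableAt ℝ Φ (Kerr.starChart a q) := hΦ.differentiableAt (by simp)
  have h1 : ContDiffAt ℝ ∞ (rDeriv a Φ) (Kerr.starChart a q) := contDiffAt_rDeriv hx hΦ
  have h0 : ContDiffAt ℝ ∞ (tDeriv Φ) (Kerr.starChart a q) := contDiffAt_tDeriv hΦ
  obtain ⟨e1, e0⟩ := pd_starPull_eventuallyEq hr hΦ
  have h11 : pd 1 (pd 1 (Kerr.starPull a Φ)) q = Kerr.starPull a (rDeriv a (rDeriv a Φ)) q := by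
    rw [pd_apply, e1.fderiv_eq, ← pd_apply, pd_one_starPull hr (h1.differentiableAt (by simp))]
  have h10 : pd 1 (pd 0 (Kerr.starPull a Φ)) q = Kerr.starPull a (rDeriv a (tDeriv Φ)) q := by
    rw [pd_apply, e0.fderiv_eq, ← pd_apply, pd_one_starPull hr (h0.differentiableAt (by simp))]
  have h00 : pd 0 (pd 0 (Kerr.starPull a Φ)) q = Kerr.starPull a (tDeriv (tDeriv Φ)) q := by
    rw [pd_apply, e0.fderiv_eq, ← pd_apply, pd_zero_starPull (h0.differentiableAt (by simp))]
  simp only [radOp, radOpChart, h11, h10, h00, pd_one_starPull hr hΦd, pd_zero_starPull hΦd,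
    Kerr.starPull_apply, Kerr.radius_starChart a hr]

end Pullback

/-! ### `∂_Φ F = 0` for functions axisymmetric on `{r > 0}` -/

/-- **`DΦ(x)(Φ_axial(x)) = 0`** for `Φ` axisymmetric on `{r > 0}` and differentiable at `x`,
`r(x) > 0` (chain rule along the orbit `α ↦ R_α x ⊆ {r > 0}`). [cite: ONeill1995, Ch. 2 §2.2] -/
theorem fderiv_axialVector_eq_zero_of_invariant_pos {a : ℝ} {Φ : E4 → ℝ}
    (haxi : ∀ β z, 0 < Kerr.radius a z → Φ (E4.axialRotation β z) = Φ z) {x : E4}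
    (hx : 0 < Kerr.radius a x) (hd : DifferentiableAt ℝ Φ x) :
    fderiv ℝ Φ x (Kerr.axialVector x) = 0 := by
  have hd' : HasFDerivAt Φ (fderiv ℝ Φ x) (E4.axialRotation 0 x) := by
    rw [E4.axialRotation_zero_apply]; exact hd.hasFDerivAt
  have h1 : HasDerivAt (fun α : ℝ ↦ Φ (E4.axialRotation α x)) (fderiv ℝ Φ x (Kerr.axialVector x)) 0 :=
    hd'.comp_hasDerivAt (0 : ℝ) (Kerr.hasDerivAt_axialRotation x)
  have h2 : HasDerivAt (fun α : ℝ ↦ Φ (E4.axialRotation α x)) 0 0 := by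
    have : (fun α : ℝ ↦ Φ (E4.axialRotation α x)) = fun _ ↦ Φ x := funext fun α ↦ haxi α x hx
    rw [this]
    exact hasDerivAt_const 0 _
  exact h1.unique h2

/-! ### The radial Carter operator maps axisymmetric solutions to solutions -/

section Solutions

open Kerr.StarCoord

variable [Kerr.Facts] [Kerr.SliceFacts] {M r₀ : ℝ} {U₀ : Set (Kerr.region M r₀)} {Φ : E4 → ℝ}

/-- The coordinate expression of `□_g` (`∑ g^{μν}∂_μ∂_ν + ∑ c^ν∂_ν`) of a function on the chart.
[cite: KerrSchild1965, §2] -/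
def coordWave (M a : ℝ) (Φ : E4 → ℝ) (x : E4) : ℝ :=
  ∑ μ, ∑ ν, Kerr.inverseMetric M a x μ ν * fderiv ℝ (fderiv ℝ Φ) x (E4.basisVector μ) (E4.basisVector ν) +
    ∑ ν, Kerr.divInverseMetric M a x ν * fderiv ℝ Φ x (E4.basisVector ν)

omit [Kerr.Facts] [Kerr.SliceFacts] in
/-- **From the chart equation to the separated equation.** With `G = Φ ∘ κ` smooth on an open set
`W` of coordinate space on which `r = q 1 > 0`, `sin θ ≠ 0`, `∂_φ G = 0`, and the coordinate wave
expression of `Φ` vanishes at `κ q` for `q ∈ W`: then `𝓡 G + 𝓐 G = 0` on `W`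
(`Kerr.blSigma_mul_coordWave_starChart`; the `φ`-terms drop out). [cite: Aretakis2012, §2.4 and §5.3] -/
theorem radOp_add_angOp_eq_zero (M a : ℝ) {W : Set E4} (hW : IsOpen W)
    (hW1 : ∀ q ∈ W, 0 < q 1) (hWs : ∀ q ∈ W, Real.sin (q 2) ≠ 0)
    (hG : ContDiffOn ℝ ∞ (Kerr.starPull a Φ) W) (hΦ : ∀ q ∈ W, ContDiffAt ℝ ∞ Φ (Kerr.starChart a q))
    (h3 : EqOn (pd 3 (Kerr.starPull a Φ)) 0 W)
    (hwave : ∀ q ∈ W, coordWave M a Φ (Kerr.starChart a q) = 0) :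
    ∀ q ∈ W, radOp M a (Kerr.starPull a Φ) q + angOp a (Kerr.starPull a Φ) q = 0 := by
  intro q hq
  have hr := hW1 q hq
  have hs := hWs q hq
  have hGq : ContDiffAt ℝ ∞ (Kerr.starPull a Φ) q := hG.contDiffAt (hW.mem_nhds hq)
  have key := Kerr.blSigma_mul_coordWave_starChart (a := a) (Φ := Φ) (q := q) M hr hs
    ((hΦ q hq).of_le (WithTop.coe_le_coe.mpr le_top))
  rw [show (∑ μ, ∑ ν, Kerr.inverseMetric M a (Kerr.starChart a q) μ ν *
      fderiv ℝ (fderiv ℝ Φ) (Kerr.starChart a q) (E4.basisVector μ) (E4.basisVector ν) +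
      ∑ ν, Kerr.divInverseMetric M a (Kerr.starChart a q) ν * fderiv ℝ Φ (Kerr.starChart a q) (E4.basisVector ν)) =
      coordWave M a Φ (Kerr.starChart a q) from rfl, hwave q hq, mul_zero] at key
  -- second derivatives as iterated coordinate derivatives; the `φ`-terms vanish
  have hdd : ∀ i j, fderiv ℝ (fderiv ℝ (Kerr.starPull a Φ)) q (E4.basisVector i) (E4.basisVector j) =
      pd i (pd j (Kerr.starPull a Φ)) q := fun i j ↦ (pd_pd_eq_fderiv_fderiv hGq i j).symm
  have hd : ∀ i, fderiv ℝ (Kerr.starPull a Φ) q (E4.basisVector i) = pd i (Kerr.starPull a Φ) q := fun i ↦ rfl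
  have h33 : pd 3 (pd 3 (Kerr.starPull a Φ)) q = 0 := pd_pd_three_eq_zero hW h3 3 hq
  have h13 : pd 1 (pd 3 (Kerr.starPull a Φ)) q = 0 := pd_pd_three_eq_zero hW h3 1 hq
  simp only [hdd, hd, h33, h13, mul_zero, add_zero] at key
  have hsc := Real.sin_sq_add_cos_sq (q 2)
  simp only [radOp, angOp]
  linear_combination -key + (a ^ 2 * pd 0 (pd 0 (Kerr.starPull a Φ)) q) * hsc

variable (hM : 0 < M) (hr₀ : r₀ ∈ Set.Ioo 0 M) (hU₀ : IsOpen U₀)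
  (hΦ : ∀ x ∈ U₀, ContDiffAt ℝ ∞ Φ x)
  (haxi : ∀ β z, 0 < Kerr.radius M z → Φ (E4.axialRotation β z) = Φ z)
  (hsol : ∀ x ∈ U₀, (Kerr.smoothMetric M M r₀).toPseudoRiemannianMetric.dalembertian
    (fun y : Kerr.region M r₀ ↦ Φ y) x = 0)
include hM hr₀ hU₀ hΦ haxi hsol

omit hM hr₀ in
/-- **The separated equations along the chart over `U₀`.** With `V = val '' U₀` and the coordinate set
`W = {q | q 1 > 0, sin (q 2) ≠ 0, κ q ∈ V}` (open), the pull-back `G = Φ ∘ κ` of an axisymmetric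
solution is smooth on `W` with `∂_φ G = 0`, and both `G` and `𝓡 G` satisfy the separated equation
`𝓡 · + 𝓐 · = 0` on `W` (`radOp_add_angOp_eq_zero`, `separated_radOp`). [cite: Aretakis2012, §5.3] -/
theorem separated_equations_starPull :
    IsOpen {q : E4 | 0 < q 1 ∧ Real.sin (q 2) ≠ 0 ∧ Kerr.starChart M q ∈ Subtype.val '' U₀} ∧
    ContDiffOn ℝ ∞ (Kerr.starPull M Φ) {q : E4 | 0 < q 1 ∧ Real.sin (q 2) ≠ 0 ∧ Kerr.starChart M q ∈ Subtype.val '' U₀} ∧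
    EqOn (pd 3 (Kerr.starPull M Φ)) 0 {q : E4 | 0 < q 1 ∧ Real.sin (q 2) ≠ 0 ∧ Kerr.starChart M q ∈ Subtype.val '' U₀} ∧
    (∀ q ∈ {q : E4 | 0 < q 1 ∧ Real.sin (q 2) ≠ 0 ∧ Kerr.starChart M q ∈ Subtype.val '' U₀},
      radOp M M (Kerr.starPull M Φ) q + angOp M (Kerr.starPull M Φ) q = 0) ∧
    (∀ q ∈ {q : E4 | 0 < q 1 ∧ Real.sin (q 2) ≠ 0 ∧ Kerr.starChart M q ∈ Subtype.val '' U₀},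
      radOp M M (radOp M M (Kerr.starPull M Φ)) q + angOp M (radOp M M (Kerr.starPull M Φ)) q = 0) := by
  set V : Set E4 := Subtype.val '' U₀ with hVdef
  have hV : IsOpen V := (Kerr.region M r₀).isOpen.isOpenMap_subtype_val U₀ hU₀
  have hVU : ∀ z ∈ V, ∃ hz : z ∈ Kerr.region M r₀, (⟨z, hz⟩ : Kerr.region M r₀) ∈ U₀ := by
    rintro _ ⟨y, hyU, rfl⟩; exact ⟨y.2, hyU⟩
  have hΦV : ∀ z ∈ V, ContDiffAt ℝ ∞ Φ z := by
    rintro _ ⟨y, hyU, rfl⟩; exact hΦ y hyU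
  have hVpos : ∀ z ∈ V, 0 < Kerr.radius M z := by
    rintro _ ⟨y, _, rfl⟩; exact Kerr.radius_pos_of_mem_region y.2
  set W : Set E4 := {q : E4 | 0 < q 1 ∧ Real.sin (q 2) ≠ 0 ∧ Kerr.starChart M q ∈ V} with hWdef
  have hW : IsOpen W := by
    refine (isOpen_lt continuous_const (PiLp.continuous_apply 2 _ 1)).inter
      ((isOpen_ne_fun (Real.continuous_sin.comp (PiLp.continuous_apply 2 _ 2)) continuous_const).inter
      (hV.preimage (Kerr.contDiff_starChart M (n := 0)).continuous))
  have hW1 : ∀ q ∈ W, 0 < q 1 := fun q hq ↦ hq.1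
  have hWs : ∀ q ∈ W, Real.sin (q 2) ≠ 0 := fun q hq ↦ hq.2.1
  have hWV : ∀ q ∈ W, Kerr.starChart M q ∈ V := fun q hq ↦ hq.2.2
  have hΦW : ∀ q ∈ W, ContDiffAt ℝ ∞ Φ (Kerr.starChart M q) := fun q hq ↦ hΦV _ (hWV q hq)
  have hG : ContDiffOn ℝ ∞ (Kerr.starPull M Φ) W := fun q hq ↦
    (Kerr.contDiffAt_comp_starChart (hΦW q hq)).contDiffWithinAt
  have h3 : EqOn (pd 3 (Kerr.starPull M Φ)) 0 W := by
    intro q hq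
    have hxq : 0 < Kerr.radius M (Kerr.starChart M q) := hVpos _ (hWV q hq)
    rw [pd_three_starPull ((hΦW q hq).differentiableAt (by simp)), Pi.zero_apply]
    exact fderiv_axialVector_eq_zero_of_invariant_pos haxi hxq ((hΦW q hq).differentiableAt (by simp))
  have hwave : ∀ q ∈ W, coordWave M M Φ (Kerr.starChart M q) = 0 := by
    intro q hq
    obtain ⟨hz, hzU⟩ := hVU _ (hWV q hq)
    have h := hsol _ hzU
    rwa [dalembertian_eq_hessian_add_firstOrder M M r₀ (ψ := fun y : Kerr.region M r₀ ↦ Φ y) (Φ := Φ)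
      (fun _ ↦ rfl) ⟨_, hz⟩ ((hΦ _ hzU).of_le (WithTop.coe_le_coe.mpr le_top))] at h
  have hsep : ∀ q ∈ W, radOp M M (Kerr.starPull M Φ) q + angOp M (Kerr.starPull M Φ) q = 0 :=
    radOp_add_angOp_eq_zero M M hW hW1 hWs hG hΦW h3 hwave
  exact ⟨hW, hG, h3, hsep, separated_radOp hW hWs hG hsep⟩

omit hr₀ in
/-- **The radial Carter operator of an axisymmetric solution solves the coordinate wave equation at
the off-axis points** of `U₀` (through the Kerr-star coordinates of the point:
`Kerr.blSigma_mul_coordWave_starChart`, `radOp_add_angOp_eq_zero`, `separated_radOp`,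
`radOp_starPull`). [cite: Aretakis2012, §5.3] -/
theorem coordWave_radOpChart_eq_zero_of_offAxis (x : Kerr.region M r₀) (hx : x ∈ U₀)
    (hoff : (x : E4) 1 ≠ 0 ∨ (x : E4) 2 ≠ 0) :
    coordWave M M (radOpChart M M Φ) x = 0 := by
  obtain ⟨hW, hG, h3, hsep, hsepR⟩ := separated_equations_starPull hU₀ hΦ haxi hsol
  set V : Set E4 := Subtype.val '' U₀ with hVdef
  have hV : IsOpen V := (Kerr.region M r₀).isOpen.isOpenMap_subtype_val U₀ hU₀
  have hΦV : ∀ z ∈ V, ContDiffAt ℝ ∞ Φ z := by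
    rintro _ ⟨y, hyU, rfl⟩; exact hΦ y hyU
  set W : Set E4 := {q : E4 | 0 < q 1 ∧ Real.sin (q 2) ≠ 0 ∧ Kerr.starChart M q ∈ V} with hWdef
  set G : E4 → ℝ := Kerr.starPull M Φ with hGdef
  have hRG : ContDiffOn ℝ ∞ (radOp M M G) W := contDiffOn_radOp hW hG
  have h3R : EqOn (pd 3 (radOp M M G)) 0 W := pd_three_radOp_eq_zero hW hG h3
  -- the coordinates of the point
  set p : E4 := (x : E4) with hpdef
  have hpV : p ∈ V := ⟨x, hx, rfl⟩
  have hppos : 0 < Kerr.radius M p := Kerr.radius_pos_of_mem_region x.2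
  set y : E3 := E4.spatial p with hydef
  have hpy : p = E4.ofTimeSpace (p 0) y := (E4.ofTimeSpace_time_spatial p).symm
  have hry : Kerr.radius M (E4.ofTimeSpace 0 y) = Kerr.radius M p := by
    rw [hydef, Kerr.radius_ofTimeSpace_spatial]
  have hyoff : y 0 ≠ 0 ∨ y 1 ≠ 0 := by
    simp only [hydef, E4.spatial_apply]; exact hoff
  obtain ⟨θ, hθ, φ, hk⟩ := Kerr.exists_kerrStar_eq (a := M) (y := y) (by rw [hry]; exact hppos) hyoff
  rw [hry] at hk
  set q : E4 := WithLp.toLp 2 ![p 0, Kerr.radius M p, θ, φ] with hqdef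
  have hq0 : q 0 = p 0 := rfl
  have hq1 : q 1 = Kerr.radius M p := rfl
  have hq2 : q 2 = θ := rfl
  have hq3 : q 3 = φ := rfl
  have hκ : Kerr.starChart M q = p := by
    rw [Kerr.starChart, hq0, hq1, hq2, hq3, hk, ← hpy]
  have hqW : q ∈ W := ⟨by rw [hq1]; exact hppos, by rw [hq2]; exact (Real.sin_pos_of_pos_of_lt_pi hθ.1 hθ.2).ne',
    by rw [hκ]; exact hpV⟩
  -- the radial operator of `Φ` along the chart near `q`
  set Ψ : E4 → ℝ := radOpChart M M Φ with hΨdef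
  have hΨp : ContDiffAt ℝ ∞ Ψ p := contDiffAt_radOpChart M hppos (hΦV p hpV)
  set W' : Set E4 := {q' : E4 | 0 < q' 1 ∧ Kerr.starChart M q' ∈ V} with hW'def
  have hW' : IsOpen W' := (isOpen_lt continuous_const (PiLp.continuous_apply 2 _ 1)).inter
    (hV.preimage (Kerr.contDiff_starChart M (n := 0)).continuous)
  have hqW' : q ∈ W' := ⟨hqW.1, hqW.2.2⟩
  have hWW' : W ⊆ W' := fun q' hq' ↦ ⟨hq'.1, hq'.2.2⟩
  have hpull : EqOn (Kerr.starPull M Ψ) (radOp M M G) W' := fun q' hq' ↦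
    (radOp_starPull M hq'.1 (hΦV _ hq'.2)).symm
  -- the coordinate wave expression of `Ψ` at `p = κ q`
  have key := Kerr.blSigma_mul_coordWave_starChart (a := M) (Φ := Ψ) (q := q) M hqW.1 hqW.2.1
    (by rw [hκ]; exact hΨp.of_le (WithTop.coe_le_coe.mpr le_top))
  rw [hκ] at key
  have hΨG : ContDiffAt ℝ ∞ (Kerr.starPull M Ψ) q :=
    (hRG.contDiffAt (hW.mem_nhds hqW)).congr_of_eventuallyEq (hpull.eventuallyEq_of_mem (hW'.mem_nhds hqW'))
  have hdd : ∀ i j, fderiv ℝ (fderiv ℝ (Kerr.starPull M Ψ)) q (E4.basisVector i) (E4.basisVector j) =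
      pd i (pd j (radOp M M G)) q := by
    intro i j
    rw [← pd_pd_eq_fderiv_fderiv hΨG i j, pd_congr hW' (pd_congr hW' hpull j) i hqW']
  have hd : ∀ i, fderiv ℝ (Kerr.starPull M Ψ) q (E4.basisVector i) = pd i (radOp M M G) q := by
    intro i
    rw [← pd_apply, pd_congr hW' hpull i hqW']
  have h33 : pd 3 (pd 3 (radOp M M G)) q = 0 := pd_pd_three_eq_zero hW h3R 3 hqW
  have h13 : pd 1 (pd 3 (radOp M M G)) q = 0 := pd_pd_three_eq_zero hW h3R 1 hqW
  simp only [hdd, hd, h33, h13, mul_zero, add_zero] at key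
  have hsc := Real.sin_sq_add_cos_sq (q 2)
  have hS : 0 < q 1 ^ 2 + M ^ 2 * Real.cos (q 2) ^ 2 := by have := hqW.1; positivity
  have hsum := hsepR q hqW
  simp only [radOp, angOp] at hsum
  -- `Σ · coordWave Ψ p = 𝓡𝓡G + 𝓐𝓡G = 0`
  have hzero : (q 1 ^ 2 + M ^ 2 * Real.cos (q 2) ^ 2) * coordWave M M Ψ p = 0 := by
    unfold coordWave
    linear_combination key + hsum - (M ^ 2 * pd 0 (pd 0 (radOp M M G)) q) * hsc
  exact (mul_eq_zero.mp hzero).resolve_left hS.ne'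

/-- **The radial Carter operator of an axisymmetric solution is a solution**: `□_g (𝓡Φ) = 0` on
`U₀` for `Φ` of class `C^∞` on `U₀`, axisymmetric on `{r > 0}`, with `□_g Φ = 0` on `U₀` (off the
axis by `coordWave_radOpChart_eq_zero_of_offAxis`, on the axis by continuity). On axisymmetric
solutions `𝓡Φ = −QΦ`, `Q` the Carter operator, so this is "`Qψ` is also a solution" (Aretakis, JFA
263 (2012), §5.3), derived here from the explicit coordinate form of `□_g`.
[cite: Aretakis2012, §5.3] -/
theorem dalembertian_radOpChart_eq_zero (x : Kerr.region M r₀) (hx : x ∈ U₀) :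
    (Kerr.smoothMetric M M r₀).toPseudoRiemannianMetric.dalembertian
      (fun y : Kerr.region M r₀ ↦ radOpChart M M Φ y) x = 0 := by
  obtain ⟨hr₀pos, hr₀M⟩ := hr₀
  set V : Set E4 := Subtype.val '' U₀ with hVdef
  have hV : IsOpen V := (Kerr.region M r₀).isOpen.isOpenMap_subtype_val U₀ hU₀
  have hVU : ∀ z ∈ V, ∃ hz : z ∈ Kerr.region M r₀, (⟨z, hz⟩ : Kerr.region M r₀) ∈ U₀ := by
    rintro _ ⟨y, hyU, rfl⟩; exact ⟨y.2, hyU⟩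
  have hΦV : ∀ z ∈ V, ContDiffAt ℝ ∞ Φ z := by
    rintro _ ⟨y, hyU, rfl⟩; exact hΦ y hyU
  have hVpos : ∀ z ∈ V, 0 < Kerr.radius M z := by
    rintro _ ⟨y, _, rfl⟩; exact Kerr.radius_pos_of_mem_region y.2
  set Ψ : E4 → ℝ := radOpChart M M Φ with hΨdef
  have hΨV : ∀ z ∈ V, ContDiffAt ℝ ∞ Ψ z := fun z hz ↦ contDiffAt_radOpChart M (hVpos z hz) (hΦV z hz)
  have hxpos : 0 < Kerr.radius M x := Kerr.radius_pos_of_mem_region x.2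
  rw [dalembertian_eq_hessian_add_firstOrder M M r₀ (ψ := fun y : Kerr.region M r₀ ↦ Ψ y) (Φ := Ψ)
    (fun _ ↦ rfl) x ((hΨV x ⟨x, hx, rfl⟩).of_le (WithTop.coe_le_coe.mpr le_top))]
  show coordWave M M Ψ x = 0
  -- the coordinate wave expression is continuous on `V` and vanishes off the axis
  have hoff : ∀ z ∈ V, (z 1 ≠ 0 ∨ z 2 ≠ 0) → coordWave M M Ψ z = 0 := by
    intro z hz hzoff
    obtain ⟨hz', hzU⟩ := hVU z hz
    exact coordWave_radOpChart_eq_zero_of_offAxis hM hU₀ hΦ haxi hsol ⟨z, hz'⟩ hzU hzoff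
  have hcont : ContinuousOn (coordWave M M Ψ) V := by
    have hB : ContinuousOn (fderiv ℝ (fderiv ℝ Ψ)) V := fun z hz ↦
      (((hΨV z hz).fderiv_right (m := ∞) le_rfl).fderiv_right (m := ∞) le_rfl).continuousAt.continuousWithinAt
    have hL : ContinuousOn (fderiv ℝ Ψ) V := fun z hz ↦
      ((hΨV z hz).fderiv_right (m := ∞) le_rfl).continuousAt.continuousWithinAt
    have hg : ∀ μ ν, ContinuousOn (fun w ↦ Kerr.inverseMetric M M w μ ν) V := fun μ ν z hz ↦
      (Kerr.contDiffAt_inverseMetric M M (hVpos z hz) μ ν (n := 0)).continuousAt.continuousWithinAt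
    have hc : ∀ ν, ContinuousOn (fun w ↦ Kerr.divInverseMetric M M w ν) V := fun ν z hz ↦
      (contDiffAt_divInverseMetric M M (hVpos z hz) ν (n := 0)).continuousAt.continuousWithinAt
    unfold coordWave
    exact (continuousOn_finsetSum _ fun μ _ ↦ continuousOn_finsetSum _ fun ν _ ↦
      (hg μ ν).mul ((hB.clm_apply continuousOn_const).clm_apply continuousOn_const)).add
      (continuousOn_finsetSum _ fun ν _ ↦ (hc ν).mul (hL.clm_apply continuousOn_const))
  by_cases hax : (x : E4) 1 ≠ 0 ∨ (x : E4) 2 ≠ 0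
  · exact hoff _ ⟨x, hx, rfl⟩ hax
  push Not at hax
  -- approach the axis point along `t ↦ x + t ∂₁` (off the axis for `t ≠ 0`)
  set γ : ℝ → E4 := fun t ↦ (x : E4) + t • E4.basisVector 1 with hγ
  have hγc : Continuous γ := continuous_const.add (continuous_id.smul continuous_const)
  have hγ0 : γ 0 = x := by simp [hγ]
  have hxV : (x : E4) ∈ V := ⟨x, hx, rfl⟩
  have hev : ∀ᶠ t in 𝓝 (0 : ℝ), γ t ∈ V :=
    hγc.continuousAt.preimage_mem_nhds (by rw [hγ0]; exact hV.mem_nhds hxV)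
  have hev' : ∀ᶠ t in 𝓝[≠] (0 : ℝ), coordWave M M Ψ (γ t) = 0 := by
    filter_upwards [mem_nhdsWithin_of_mem_nhds hev, self_mem_nhdsWithin] with t ht ht0
    refine hoff _ ht (Or.inl ?_)
    show ((x : E4) + t • E4.basisVector 1) 1 ≠ 0
    rw [PiLp.add_apply, PiLp.smul_apply, basisVector_apply, if_pos rfl, hax.1, smul_eq_mul, mul_one,
      zero_add]
    exact ht0
  have htend : Tendsto (fun t ↦ coordWave M M Ψ (γ t)) (𝓝[≠] 0) (𝓝 (coordWave M M Ψ x)) := by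
    have h1 : Tendsto γ (𝓝[≠] 0) (𝓝[V] (x : E4)) := by
      refine tendsto_nhdsWithin_iff.2 ⟨?_, mem_nhdsWithin_of_mem_nhds hev⟩
      rw [← hγ0]
      exact hγc.continuousAt.tendsto.mono_left nhdsWithin_le_nhds
    exact (hcont _ hxV).tendsto.comp h1
  have hconst : Tendsto (fun t ↦ coordWave M M Ψ (γ t)) (𝓝[≠] 0) (𝓝 0) :=
    tendsto_const_nhds.congr' (hev'.mono fun t ht ↦ ht.symm)
  exact tendsto_nhds_unique htend hconst

end Solutions

/-! ### The radial Carter operator of a localised solution is localised -/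

section Localisation

/-- **First bookkeeping lemma**: if `DF(x) = 0` and `D(DF)` has derivative `0` at `x`, then for a
field `V` differentiable at `x` the function `y ↦ DF(y)(V y)` vanishes at `x` together with its
derivative. [folklore] -/
theorem fderiv_apply_field_localised {F : E4 → ℝ} {V : E4 → E4} {x : E4} (h1 : fderiv ℝ F x = 0)
    (h2 : HasFDerivAt (fderiv ℝ F) (0 : E4 →L[ℝ] E4 →L[ℝ] ℝ) x) (hV : DifferentiableAt ℝ V x) :
    (fun y ↦ fderiv ℝ F y (V y)) x = 0 ∧ fderiv ℝ (fun y ↦ fderiv ℝ F y (V y)) x = 0 := by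
  refine ⟨by simp [h1], ?_⟩
  have h := h2.clm_apply hV.hasFDerivAt
  rw [h.fderiv, h1]
  ext v
  simp

/-- **Second bookkeeping lemma**: if `DF(x) = 0`, `D²F(x) = 0` and `D(D²F)` has derivative `0` at
`x`, `F` is `C³` near `x` and the field `V` is `C²` near `x`, then `D(y ↦ DF(y)(V y))` has derivative
`0` at `x` (all slots computed as derivatives of scalar functions along the field). [folklore] -/
theorem hasFDerivAt_fderiv_apply_field {F : E4 → ℝ} {V : E4 → E4} {x : E4} (hF : ContDiffAt ℝ 3 F x)
    (hV2 : ContDiffAt ℝ 2 V x) (h1 : fderiv ℝ F x = 0) (h2 : fderiv ℝ (fderiv ℝ F) x = 0)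
    (h3 : HasFDerivAt (fderiv ℝ (fderiv ℝ F)) (0 : E4 →L[ℝ] E4 →L[ℝ] E4 →L[ℝ] ℝ) x) :
    HasFDerivAt (fderiv ℝ (fun y ↦ fderiv ℝ F y (V y))) (0 : E4 →L[ℝ] E4 →L[ℝ] ℝ) x := by
  set N : E4 → ℝ := fun y ↦ fderiv ℝ F y (V y) with hN
  -- `N` is `C²` near `x`, so `DN` is differentiable at `x`
  have hN2 : ContDiffAt ℝ 2 N x :=
    (hF.fderiv_right (m := 2) le_rfl).clm_apply (hV2)
  have hdN : DifferentiableAt ℝ (fderiv ℝ N) x := (hN2.fderiv_right (m := 1) le_rfl).differentiableAt one_ne_zero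
  suffices hzero : fderiv ℝ (fderiv ℝ N) x = 0 by
    rw [← hzero]; exact hdN.hasFDerivAt
  -- near `x`: `DN(y) w = D²F(y) w (V y) + DF(y)(DV(y) w)`
  have hevF : ∀ᶠ y in 𝓝 x, ContDiffAt ℝ 3 F y := hF.eventually (by simp)
  have hevV : ∀ᶠ y in 𝓝 x, ContDiffAt ℝ 2 V y := hV2.eventually (by simp)
  have hev : ∀ w : E4, (fun y ↦ fderiv ℝ N y w) =ᶠ[𝓝 x]
      fun y ↦ fderiv ℝ (fderiv ℝ F) y w (V y) + fderiv ℝ F y (fderiv ℝ V y w) := by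
    intro w
    filter_upwards [hevF, hevV] with y hy hVy
    have hB : HasFDerivAt (fderiv ℝ F) (fderiv ℝ (fderiv ℝ F) y) y :=
      ((hy.fderiv_right (m := 2) le_rfl).differentiableAt two_ne_zero).hasFDerivAt
    have hVd : HasFDerivAt V (fderiv ℝ V y) y := (hVy.differentiableAt two_ne_zero).hasFDerivAt
    rw [(hB.clm_apply hVd).fderiv]
    simp only [_root_.add_apply, ContinuousLinearMap.comp_apply, ContinuousLinearMap.flip_apply]
    ring
  -- derivative data at `x`
  have hVd : HasFDerivAt V (fderiv ℝ V x) x := (hV2.differentiableAt two_ne_zero).hasFDerivAt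
  have hdV : HasFDerivAt (fderiv ℝ V) (fderiv ℝ (fderiv ℝ V) x) x :=
    ((hV2.fderiv_right (m := 1) le_rfl).differentiableAt one_ne_zero).hasFDerivAt
  have hcF : HasFDerivAt (fderiv ℝ F) (fderiv ℝ (fderiv ℝ F) x) x :=
    ((hF.fderiv_right (m := 2) le_rfl).differentiableAt two_ne_zero).hasFDerivAt
  ext u w
  -- `D²N(x)(u)(w) = D[y ↦ DN(y) w](x) u`
  rw [_root_.zero_apply, _root_.zero_apply, ← fderiv_clm_apply_const_apply hdN w u, (hev w).fderiv_eq]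
  -- the two summands have derivative zero at `x`
  have hc1 : HasFDerivAt (fun y ↦ fderiv ℝ (fderiv ℝ F) y w) ((0 : E4 →L[ℝ] E4 →L[ℝ] E4 →L[ℝ] ℝ).flip w) x := by
    simpa using h3.clm_apply (hasFDerivAt_const w x)
  have hs1 := hc1.clm_apply hVd
  have hu2 : HasFDerivAt (fun y ↦ fderiv ℝ V y w) ((fderiv ℝ (fderiv ℝ V) x).flip w) x := by
    simpa using hdV.clm_apply (hasFDerivAt_const w x)
  have hs2 := hcF.clm_apply hu2
  have hsum : HasFDerivAt (fun y ↦ fderiv ℝ (fderiv ℝ F) y w (V y) + fderiv ℝ F y (fderiv ℝ V y w)) _ x :=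
    hs1.add hs2
  rw [hsum.fderiv, h1, h2]
  simp

end Localisation


section LocalisationMain

variable [Kerr.Facts] [Kerr.SliceFacts] {M r₀ : ℝ} {U₀ : Set (Kerr.region M r₀)} {Φ : E4 → ℝ} {ρ : ℝ}

/-- **The radial Carter operator of a localised solution is localised.** Let `Φ` be smooth on `E4`,
solve `□_{g_{M,M}} = 0` as a chart function on the open `U₀`, and vanish with `DΦ` at the points of
`U₀ ∩ {t* = 0}` with `‖x⃗‖ > ρ`. Then `𝓡Φ` (`radOpChart M M Φ`) vanishes there together with
`D(𝓡Φ)` (the jets of `Φ` up to order three vanish at these points). [folklore] -/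
theorem radOpChart_localised (hM : 0 ≤ M) (hΦ : ContDiff ℝ ∞ Φ) (hU₀ : IsOpen U₀)
    (hsol : ∀ x ∈ U₀, (Kerr.smoothMetric M M r₀).toPseudoRiemannianMetric.dalembertian
      (fun y : Kerr.region M r₀ ↦ Φ y) x = 0)
    (hloc : ∀ x ∈ U₀, (x : E4) 0 = 0 → ρ < E4.spatialNorm (x : E4) → Φ x = 0 ∧ fderiv ℝ Φ x = 0)
    (x : Kerr.region M r₀) (hx : x ∈ U₀) (hx0 : (x : E4) 0 = 0) (hxρ : ρ < E4.spatialNorm (x : E4)) :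
    radOpChart M M Φ x = 0 ∧ fderiv ℝ (radOpChart M M Φ) x = 0 := by
  have hxpos : 0 < Kerr.radius M x := Kerr.radius_pos_of_mem_region x.2
  -- the jets of `Φ` at `x`
  have J1 : fderiv ℝ Φ x = 0 := (hloc x hx hx0 hxρ).2
  have J2 : fderiv ℝ (fderiv ℝ Φ) x = 0 := fderiv_fderiv_eq_zero_of_localised hM hΦ hU₀ hsol hloc x hx hx0 hxρ
  have J3 : fderiv ℝ (fderiv ℝ (fderiv ℝ Φ)) x = 0 :=
    fderiv_fderiv_fderiv_eq_zero_of_localised hM hΦ hU₀ hsol hloc x hx hx0 hxρ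
  have h1 : ContDiff ℝ ∞ (fderiv ℝ Φ) := hΦ.fderiv_right (m := ∞) le_rfl
  have h2 : ContDiff ℝ ∞ (fderiv ℝ (fderiv ℝ Φ)) := h1.fderiv_right (m := ∞) le_rfl
  have hinf : (∞ : WithTop ℕ∞) ≠ 0 := WithTop.coe_ne_zero.mpr ENat.top_ne_zero
  have hJ2 : HasFDerivAt (fderiv ℝ Φ) (0 : E4 →L[ℝ] E4 →L[ℝ] ℝ) x := by
    rw [← J2]; exact (h1.differentiable hinf x).hasFDerivAt
  have hJ3 : HasFDerivAt (fderiv ℝ (fderiv ℝ Φ)) (0 : E4 →L[ℝ] E4 →L[ℝ] E4 →L[ℝ] ℝ) x := by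
    rw [← J3]; exact (h2.differentiable hinf x).hasFDerivAt
  -- the `t*`-derivative is in the class: its second jet vanishes at `x`
  have hT : ContDiff ℝ ∞ (tDeriv Φ) := h1.clm_apply contDiff_const
  have hsolT := fun y hy ↦ dalembertian_timeDeriv_eq_zero (M := M) (r₀ := r₀) hΦ hU₀ hsol y hy
  have hlocT : ∀ y ∈ U₀, (y : E4) 0 = 0 → ρ < E4.spatialNorm (y : E4) →
      tDeriv Φ y = 0 ∧ fderiv ℝ (tDeriv Φ) y = 0 :=
    fun y hy hy0 hyρ ↦ timeDeriv_localised hM hΦ hU₀ hsol hloc y hy hy0 hyρ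
  have T1 : fderiv ℝ (tDeriv Φ) x = 0 := (hlocT x hx hx0 hxρ).2
  have T0 : tDeriv Φ x = 0 := (hlocT x hx hx0 hxρ).1
  have T2 : fderiv ℝ (fderiv ℝ (tDeriv Φ)) x = 0 :=
    fderiv_fderiv_eq_zero_of_localised hM hT hU₀ hsolT hlocT x hx hx0 hxρ
  have hT1 : ContDiff ℝ ∞ (fderiv ℝ (tDeriv Φ)) := hT.fderiv_right (m := ∞) le_rfl
  have hT2 : HasFDerivAt (fderiv ℝ (tDeriv Φ)) (0 : E4 →L[ℝ] E4 →L[ℝ] ℝ) x := by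
    rw [← T2]; exact (hT1.differentiable hinf x).hasFDerivAt
  -- the radial field near `x`
  have hV : ContDiffAt ℝ ∞ (radialVec M) x := contDiffAt_radialVec hxpos
  have hVd : DifferentiableAt ℝ (radialVec M) x := hV.differentiableAt hinf
  have he0 : DifferentiableAt ℝ (fun _ : E4 ↦ E4.basisVector 0) x := differentiableAt_const _
  -- the five building blocks: values and derivatives at `x`
  obtain ⟨N0, N1⟩ := fderiv_apply_field_localised (F := Φ) (V := radialVec M) J1 hJ2 hVd
  have hN2 : HasFDerivAt (fderiv ℝ (rDeriv M Φ)) (0 : E4 →L[ℝ] E4 →L[ℝ] ℝ) x :=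
    hasFDerivAt_fderiv_apply_field (hΦ.contDiffAt.of_le (WithTop.coe_le_coe.mpr le_top))
      (hV.of_le (WithTop.coe_le_coe.mpr le_top)) J1 J2 hJ3
  obtain ⟨NN0, NN1⟩ := fderiv_apply_field_localised (F := rDeriv M Φ) (V := radialVec M) N1 hN2 hVd
  obtain ⟨NT0, NT1⟩ := fderiv_apply_field_localised (F := tDeriv Φ) (V := radialVec M) T1 hT2 hVd
  obtain ⟨TT0, TT1⟩ := fderiv_apply_field_localised (F := tDeriv Φ) (V := fun _ ↦ E4.basisVector 0) T1 hT2 he0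
  -- differentiability of the blocks and coefficients at `x`
  have hr : DifferentiableAt ℝ (Kerr.radius M) x := (Kerr.contDiffAt_radius hxpos).differentiableAt hinf
  have dN : DifferentiableAt ℝ (rDeriv M Φ) x := (contDiffAt_rDeriv hxpos hΦ.contDiffAt).differentiableAt hinf
  have dNN : DifferentiableAt ℝ (rDeriv M (rDeriv M Φ)) x :=
    (contDiffAt_rDeriv hxpos (contDiffAt_rDeriv hxpos hΦ.contDiffAt)).differentiableAt hinf
  have dT : DifferentiableAt ℝ (tDeriv Φ) x := (contDiffAt_tDeriv hΦ.contDiffAt).differentiableAt hinf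
  have dNT : DifferentiableAt ℝ (rDeriv M (tDeriv Φ)) x :=
    (contDiffAt_rDeriv hxpos (contDiffAt_tDeriv hΦ.contDiffAt)).differentiableAt hinf
  have dTT : DifferentiableAt ℝ (tDeriv (tDeriv Φ)) x :=
    (contDiffAt_tDeriv (contDiffAt_tDeriv hΦ.contDiffAt)).differentiableAt hinf
  -- names of the blocks as they appear in `radOpChart`
  have eNN : rDeriv M (rDeriv M Φ) = fun y ↦ fderiv ℝ (rDeriv M Φ) y (radialVec M y) := rfl
  have eN : rDeriv M Φ = fun y ↦ fderiv ℝ Φ y (radialVec M y) := rfl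
  have eNT : rDeriv M (tDeriv Φ) = fun y ↦ fderiv ℝ (tDeriv Φ) y (radialVec M y) := rfl
  have eTT : tDeriv (tDeriv Φ) = fun y ↦ fderiv ℝ (tDeriv Φ) y (E4.basisVector 0) := rfl
  rw [← eNN] at NN0 NN1
  rw [← eN] at N0 N1
  rw [← eNT] at NT0 NT1
  rw [← eTT] at TT0 TT1
  constructor
  · simp only [radOpChart, NN0, N0, NT0, T0, TT0, mul_zero, add_zero, sub_zero]
  · -- derivative of the sum of products at `x`
    have hprod : ∀ {c B : E4 → ℝ}, DifferentiableAt ℝ c x → DifferentiableAt ℝ B x → B x = 0 →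
        fderiv ℝ B x = 0 → fderiv ℝ (fun y ↦ c y * B y) x = 0 := by
      intro c B hc hB hB0 hB1
      rw [fderiv_fun_mul hc hB, hB0, hB1, zero_smul, smul_zero, add_zero]
    have c1 : DifferentiableAt ℝ (fun y ↦ Kerr.radius M y ^ 2 - 2 * M * Kerr.radius M y + M ^ 2) x := by fun_prop
    have c2 : DifferentiableAt ℝ (fun y ↦ 2 * Kerr.radius M y - 2 * M) x := by fun_prop
    have c3 : DifferentiableAt ℝ (fun y ↦ 4 * M * Kerr.radius M y) x := by fun_prop
    have c5 : DifferentiableAt ℝ (fun y ↦ Kerr.radius M y ^ 2 + M ^ 2 + 2 * M * Kerr.radius M y) x := by fun_prop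
    have p1 := hprod c1 dNN NN0 NN1
    have p2 := hprod c2 dN N0 N1
    have p3 := hprod c3 dNT NT0 NT1
    have p4 := hprod (differentiableAt_const (2 * M)) dT T0 T1
    have p5 := hprod c5 dTT TT0 TT1
    have e : radOpChart M M Φ = (fun y ↦ (Kerr.radius M y ^ 2 - 2 * M * Kerr.radius M y + M ^ 2) *
        rDeriv M (rDeriv M Φ) y) + (fun y ↦ (2 * Kerr.radius M y - 2 * M) * rDeriv M Φ y) +
        (fun y ↦ 4 * M * Kerr.radius M y * rDeriv M (tDeriv Φ) y) + (fun y ↦ 2 * M * tDeriv Φ y) -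
        (fun y ↦ (Kerr.radius M y ^ 2 + M ^ 2 + 2 * M * Kerr.radius M y) * tDeriv (tDeriv Φ) y) := by
      funext y; simp only [radOpChart, Pi.add_apply, Pi.sub_apply]
    rw [e, fderiv_sub, fderiv_add, fderiv_add, fderiv_add, p1, p2, p3, p4, p5]
    · simp
    · exact c1.mul dNN
    · exact c2.mul dN
    · exact (c1.mul dNN).add (c2.mul dN)
    · exact c3.mul dNT
    · exact ((c1.mul dNN).add (c2.mul dN)).add (c3.mul dNT)
    · exact (differentiableAt_const _).mul dT
    · exact (((c1.mul dNN).add (c2.mul dN)).add (c3.mul dNT)).add ((differentiableAt_const _).mul dT)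
    · exact c5.mul dTT

end LocalisationMain

/-! ### The horizon spheres in the coordinates of the chart, and the round Laplacian of an
axisymmetric solution on them -/

section Horizon

open Kerr.StarCoord

/-- The coordinate quadruple `(σ, M, θ, φ)` of the horizon point `p_σ(θ, φ)`. [cite: Aretakis2015, §5.2] -/
def horizonCoord (M σ θ φ : ℝ) : E4 := WithLp.toLp 2 ![σ, M, θ, φ]

/-- Component. [folklore] -/
@[simp] theorem horizonCoord_apply_zero (M σ θ φ : ℝ) : horizonCoord M σ θ φ 0 = σ := rfl
/-- Component. [folklore] -/
@[simp] theorem horizonCoord_apply_one (M σ θ φ : ℝ) : horizonCoord M σ θ φ 1 = M := rfl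
/-- Component. [folklore] -/
@[simp] theorem horizonCoord_apply_two (M σ θ φ : ℝ) : horizonCoord M σ θ φ 2 = θ := rfl
/-- Component. [folklore] -/
@[simp] theorem horizonCoord_apply_three (M σ θ φ : ℝ) : horizonCoord M σ θ φ 3 = φ := rfl

/-- **`κ(σ, M, θ, φ) = p_σ(θ, φ)`**: the horizon sphere `S_σ` is `{r = M}` of the chart at time `σ`.
[cite: Aretakis2015, §5.2] -/
theorem starChart_horizonCoord (M σ θ φ : ℝ) :
    Kerr.starChart M (horizonCoord M σ θ φ) = horizonPoint M σ θ φ := by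
  rw [Kerr.starChart, horizonCoord_apply_zero, horizonCoord_apply_one, horizonCoord_apply_two,
    horizonCoord_apply_three, ← shellPoint_self]
  rfl

/-- `κ_*∂_θ = Θ` on the horizon spheres (`thetaVec`). [cite: Aretakis2015, §2.2] -/
theorem starFrame_two_horizonCoord (M σ θ φ : ℝ) :
    Kerr.starFrame M (horizonCoord M σ θ φ) 2 = thetaVec M θ φ := by
  rw [Kerr.starFrame_two, horizonCoord_apply_one, horizonCoord_apply_two, horizonCoord_apply_three]
  ext i
  refine Fin.cases ?_ (fun j ↦ ?_) i
  · simp [thetaVec]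
  · rw [E4.spaceEmbed_apply, E4.ofTimeSpace_apply_succ]
    fin_cases j <;> simp [thetaVec, sphPolar, sphAzimuth] <;> ring

/-- `∂_θ(κ_*∂_θ) = ∂_θΘ` on the horizon spheres (`dThetaVec`). [folklore] -/
theorem frameDeriv_two_horizonCoord (M θ φ : ℝ) :
    E4.spaceEmbed (M • -sphRadial θ φ + -(M * Real.sin θ) • sphAzimuth φ) = dThetaVec M θ φ := by
  ext i
  refine Fin.cases ?_ (fun j ↦ ?_) i
  · simp [dThetaVec]
  · rw [E4.spaceEmbed_apply, E4.ofTimeSpace_apply_succ]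
    fin_cases j <;> simp [dThetaVec, sphRadial, sphAzimuth] <;> ring

/-- `∂₀∂₀(Φ ∘ κ) = (TTΦ) ∘ κ` at a point over which `Φ` is `C^∞` (`r = q 1 > 0`). [folklore] -/
theorem pd_zero_pd_zero_starPull {a : ℝ} {Φ : E4 → ℝ} {q : E4} (hr : 0 < q 1)
    (hΦ : ContDiffAt ℝ ∞ Φ (Kerr.starChart a q)) :
    pd 0 (pd 0 (Kerr.starPull a Φ)) q = tDeriv (tDeriv Φ) (Kerr.starChart a q) := by
  have h0 : ContDiffAt ℝ ∞ (tDeriv Φ) (Kerr.starChart a q) := contDiffAt_tDeriv hΦ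
  obtain ⟨-, e0⟩ := pd_starPull_eventuallyEq hr hΦ
  rw [pd_apply, e0.fderiv_eq, ← pd_apply, pd_zero_starPull (h0.differentiableAt (by simp))]
  rfl

variable [Kerr.Facts] [Kerr.SliceFacts] {M r₀ : ℝ} {U₀ : Set (Kerr.region M r₀)} {Φ : E4 → ℝ}

/-- **The round Laplacian of an axisymmetric solution on the horizon spheres through the radial
Carter operator**: off the poles,
`Δ̸Φ(σ, θ, φ) = −(𝓡Φ)(p_σ(θ, φ)) − M² sin² θ · (TTΦ)(p_σ(θ, φ))`
for `Φ` smooth and axisymmetric on `E4` solving `□_{g_{M,M}} = 0` (as a chart function) on an open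
`U₀` over which the horizon point lies. (The separated equation `𝓡G + 𝓐G = 0` at the coordinate
point `(σ, M, θ, φ)`, with `𝓐G = M² sin² θ ∂₀∂₀G + ∂₂∂₂G + cot θ ∂₂G` and
`∂₂∂₂G + cot θ ∂₂G = Δ̸Φ` for axisymmetric `Φ` — Aretakis's `Qψ = Δ̸ψ + a² sin² θ TTψ` on
axisymmetric functions, JFA 263 (2012), §15, proof of Lemma 15.0.1.) [cite: Aretakis2012, Lemma 15.0.1 (proof)] -/
theorem roundLap_eq_neg_radOpChart (hM : 0 < M) (hU₀ : IsOpen U₀)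
    (hΦ : ContDiff ℝ ∞ Φ) (haxi : ∀ β z, Φ (E4.axialRotation β z) = Φ z)
    (hsol : ∀ x ∈ U₀, (Kerr.smoothMetric M M r₀).toPseudoRiemannianMetric.dalembertian
      (fun y : Kerr.region M r₀ ↦ Φ y) x = 0)
    {σ θ φ : ℝ} (hθ : Real.sin θ ≠ 0) (hp : horizonPoint M σ θ φ ∈ Subtype.val '' U₀) :
    roundLap M Φ σ θ φ =
      -radOpChart M M Φ (horizonPoint M σ θ φ) - M ^ 2 * Real.sin θ ^ 2 * tDeriv (tDeriv Φ) (horizonPoint M σ θ φ) := by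
  have hΦ' : ∀ x ∈ U₀, ContDiffAt ℝ ∞ Φ x := fun x _ ↦ hΦ.contDiffAt
  have haxi' : ∀ β z, 0 < Kerr.radius M z → Φ (E4.axialRotation β z) = Φ z := fun β z _ ↦ haxi β z
  obtain ⟨hW, hG, h3, hsep, -⟩ := separated_equations_starPull hU₀ hΦ' haxi' hsol
  set q : E4 := horizonCoord M σ θ φ with hqdef
  have hκ : Kerr.starChart M q = horizonPoint M σ θ φ := starChart_horizonCoord M σ θ φ
  have hq1 : 0 < q 1 := by rw [hqdef, horizonCoord_apply_one]; exact hM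
  have hqW : q ∈ {q : E4 | 0 < q 1 ∧ Real.sin (q 2) ≠ 0 ∧ Kerr.starChart M q ∈ Subtype.val '' U₀} :=
    ⟨hq1, by rwa [hqdef, horizonCoord_apply_two], by rwa [hκ]⟩
  have hΦq : ContDiffAt ℝ ∞ Φ (Kerr.starChart M q) := hΦ.contDiffAt
  have hGq : ContDiffAt ℝ ∞ (Kerr.starPull M Φ) q := Kerr.contDiffAt_comp_starChart hΦq
  -- the separated equation at `q`
  have key := hsep q hqW
  rw [radOp_starPull M hq1 hΦq] at key
  simp only [angOp] at key
  -- the angular terms at `q`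
  have h00 : pd 0 (pd 0 (Kerr.starPull M Φ)) q = tDeriv (tDeriv Φ) (horizonPoint M σ θ φ) := by
    rw [pd_zero_pd_zero_starPull hq1 hΦq, hκ]
  have h2 : pd 2 (Kerr.starPull M Φ) q = fderiv ℝ Φ (horizonPoint M σ θ φ) (thetaVec M θ φ) := by
    rw [pd_apply, Kerr.fderiv_starPull (hΦq.differentiableAt (by simp)) 2, hqdef,
      starFrame_two_horizonCoord, ← hqdef, hκ]
  have h22 : pd 2 (pd 2 (Kerr.starPull M Φ)) q =
      fderiv ℝ (fderiv ℝ Φ) (horizonPoint M σ θ φ) (thetaVec M θ φ) (thetaVec M θ φ) +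
        fderiv ℝ Φ (horizonPoint M σ θ φ) (dThetaVec M θ φ) := by
    obtain ⟨-, -, -, e22, -, -⟩ := Kerr.fderiv_fderiv_starPull (a := M) (q := q)
      (hΦq.of_le (WithTop.coe_le_coe.mpr le_top))
    rw [pd_pd_eq_fderiv_fderiv hGq, e22, hqdef, starFrame_two_horizonCoord, horizonCoord_apply_one,
      horizonCoord_apply_two, horizonCoord_apply_three, frameDeriv_two_horizonCoord, ← hqdef, hκ]
  rw [hκ, h00, h2, h22, show q 2 = θ from rfl] at key
  -- `Θ = −cos θ ∂_φΦ̂ − M sin θ ∂₃` and `sin θ · D²Φ(Φ̂,Φ̂) + DΦ(∂_φΦ̂) = 0` (axisymmetry)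
  have hlin : fderiv ℝ Φ (horizonPoint M σ θ φ) (thetaVec M θ φ) =
      -Real.cos θ * fderiv ℝ Φ (horizonPoint M σ θ φ) (dPhiHatVec M φ) -
        M * Real.sin θ * fderiv ℝ Φ (horizonPoint M σ θ φ) (E4.basisVector 3) := by
    rw [thetaVec_eq_dPhiHatVec, map_sub, map_smul, map_smul, smul_eq_mul, smul_eq_mul]
  have hphi := phiPhiTerm_eq_zero (M := M) (hΦ.of_le (WithTop.coe_le_coe.mpr le_top)) haxi σ hθ φ
  simp only [phiPhiTerm] at hphi
  have hsc := Real.sin_sq_add_cos_sq θ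
  simp only [roundLap]
  rw [hlin] at key
  field_simp at key
  refine mul_left_cancel₀ hθ ?_
  linear_combination key + hphi + (fderiv ℝ Φ (horizonPoint M σ θ φ) (dPhiHatVec M φ)) * hsc

end Horizon

/-! ### Sphere integrals: the round Laplacian controlled by the two solutions `𝓡Φ` and `TTΦ` -/

section SphereBound

variable [Kerr.Facts] [Kerr.SliceFacts] {M r₀ : ℝ} {U₀ : Set (Kerr.region M r₀)} {Φ : E4 → ℝ}

/-- **`∫∫ sin θ (Δ̸Φ)² ≤ 2 ∫∫ sin θ (𝓡Φ)² + 2M⁴ ∫∫ sin θ (TTΦ)²` on every horizon sphere `S_σ` over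
`U₀`** (from `roundLap_eq_neg_radOpChart` off the poles; at the poles the weight vanishes).
[cite: Aretakis2012, Lemma 15.0.1 (proof)] -/
theorem sphereIntegral_roundLap_sq_le (hM : 0 < M) (hU₀ : IsOpen U₀)
    (hΦ : ContDiff ℝ ∞ Φ) (haxi : ∀ β z, Φ (E4.axialRotation β z) = Φ z)
    (hsol : ∀ x ∈ U₀, (Kerr.smoothMetric M M r₀).toPseudoRiemannianMetric.dalembertian
      (fun y : Kerr.region M r₀ ↦ Φ y) x = 0)
    {σ : ℝ} (hσ : ∀ θ φ, horizonPoint M σ θ φ ∈ Subtype.val '' U₀) :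
    (∫ φ in (0 : ℝ)..2 * Real.pi, ∫ θ in (0 : ℝ)..Real.pi, Real.sin θ * roundLap M Φ σ θ φ ^ 2) ≤
      2 * (∫ φ in (0 : ℝ)..2 * Real.pi, ∫ θ in (0 : ℝ)..Real.pi,
          Real.sin θ * radOpChart M M Φ (horizonPoint M σ θ φ) ^ 2) +
        2 * M ^ 4 * (∫ φ in (0 : ℝ)..2 * Real.pi, ∫ θ in (0 : ℝ)..Real.pi,
          Real.sin θ * tDeriv (tDeriv Φ) (horizonPoint M σ θ φ) ^ 2) := by
  -- continuity of the three integrands in the angles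
  have hP := continuous_horizonPoint_angles M σ
  have hpos : ∀ q : ℝ × ℝ, 0 < Kerr.radius M (horizonPoint M σ q.1 q.2) := fun q ↦ by
    rw [radius_horizonPoint hM.le]; exact hM
  have hRc : Continuous fun q : ℝ × ℝ ↦ radOpChart M M Φ (horizonPoint M σ q.1 q.2) := by
    have hon : ContinuousOn (radOpChart M M Φ) {z : E4 | 0 < Kerr.radius M z} := fun z hz ↦
      (contDiffAt_radOpChart M hz hΦ.contDiffAt).continuousAt.continuousWithinAt
    exact hon.comp_continuous hP hpos
  have hTTc : Continuous fun q : ℝ × ℝ ↦ tDeriv (tDeriv Φ) (horizonPoint M σ q.1 q.2) :=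
    (contDiff_iff_contDiffAt.mpr fun z ↦ contDiffAt_tDeriv (contDiffAt_tDeriv hΦ.contDiffAt)).continuous.comp hP
  have hLc := continuous_roundLap_angles (M := M) (hΦ.of_le (WithTop.coe_le_coe.mpr le_top)) σ
  have hsin : Continuous fun q : ℝ × ℝ ↦ Real.sin q.1 := by fun_prop
  -- the pointwise inequality (weight `sin θ ≥ 0` on `[0, π]`; identity off the poles)
  have hpt : ∀ θ ∈ Icc (0 : ℝ) Real.pi, ∀ φ ∈ Icc (0 : ℝ) (2 * Real.pi),
      Real.sin θ * roundLap M Φ σ θ φ ^ 2 ≤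
        2 * (Real.sin θ * radOpChart M M Φ (horizonPoint M σ θ φ) ^ 2) +
          2 * M ^ 4 * (Real.sin θ * tDeriv (tDeriv Φ) (horizonPoint M σ θ φ) ^ 2) := by
    intro θ hθ φ _
    have hs0 : 0 ≤ Real.sin θ := Real.sin_nonneg_of_nonneg_of_le_pi hθ.1 hθ.2
    have hs1 : Real.sin θ ^ 2 ≤ 1 := by
      rw [Real.sin_sq]; nlinarith [sq_nonneg (Real.cos θ)]
    by_cases hs : Real.sin θ = 0
    · simp [hs]
    rw [roundLap_eq_neg_radOpChart hM hU₀ hΦ haxi hsol hs (hσ θ φ)]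
    set R := radOpChart M M Φ (horizonPoint M σ θ φ)
    set T := tDeriv (tDeriv Φ) (horizonPoint M σ θ φ)
    have h1 : (-R - M ^ 2 * Real.sin θ ^ 2 * T) ^ 2 ≤ 2 * R ^ 2 + 2 * (M ^ 2 * Real.sin θ ^ 2 * T) ^ 2 := by
      nlinarith [sq_nonneg (R - M ^ 2 * Real.sin θ ^ 2 * T)]
    have h2 : (M ^ 2 * Real.sin θ ^ 2 * T) ^ 2 ≤ M ^ 4 * T ^ 2 := by
      have : (M ^ 2 * Real.sin θ ^ 2 * T) ^ 2 = (Real.sin θ ^ 2) ^ 2 * (M ^ 4 * T ^ 2) := by ring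
      rw [this]
      have h4 : (Real.sin θ ^ 2) ^ 2 ≤ 1 := by nlinarith [sq_nonneg (Real.sin θ)]
      have h5 : 0 ≤ M ^ 4 * T ^ 2 := by positivity
      nlinarith [h4, h5]
    have h3 : (-R - M ^ 2 * Real.sin θ ^ 2 * T) ^ 2 ≤ 2 * R ^ 2 + 2 * (M ^ 4 * T ^ 2) := by linarith
    have h6 := mul_le_mul_of_nonneg_left h3 hs0
    linarith [h6]
  -- integrate
  calc (∫ φ in (0 : ℝ)..2 * Real.pi, ∫ θ in (0 : ℝ)..Real.pi, Real.sin θ * roundLap M Φ σ θ φ ^ 2)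
      ≤ ∫ φ in (0 : ℝ)..2 * Real.pi, ∫ θ in (0 : ℝ)..Real.pi,
          (2 * (Real.sin θ * radOpChart M M Φ (horizonPoint M σ θ φ) ^ 2) +
            2 * M ^ 4 * (Real.sin θ * tDeriv (tDeriv Φ) (horizonPoint M σ θ φ) ^ 2)) := by
        refine sphereIntegral_mono_on (hsin.mul (hLc.pow 2)) ?_ hpt
        exact (continuous_const.mul (hsin.mul (hRc.pow 2))).add (continuous_const.mul (hsin.mul (hTTc.pow 2)))
    _ = 2 * (∫ φ in (0 : ℝ)..2 * Real.pi, ∫ θ in (0 : ℝ)..Real.pi,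
          Real.sin θ * radOpChart M M Φ (horizonPoint M σ θ φ) ^ 2) +
        2 * M ^ 4 * (∫ φ in (0 : ℝ)..2 * Real.pi, ∫ θ in (0 : ℝ)..Real.pi,
          Real.sin θ * tDeriv (tDeriv Φ) (horizonPoint M σ θ φ) ^ 2) := by
        rw [sphereIntegral_add, sphereIntegral_const_mul, sphereIntegral_const_mul]
        · exact continuous_const.mul (hsin.mul (hRc.pow 2))
        · exact continuous_const.mul (hsin.mul (hTTc.pow 2))

end SphereBound

end Literature.Barriers.FinalStateConjecture.Kerr

namespace Literature.Barriers.FinalStateConjecture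

open Literature.Geometry.Lorentzian

/-! ### The reduction of the named fact to `L²(S_τ)` decay alone -/

/-- **`Aretakis2012_pointwiseDecay` from the `L²(S_τ)` decay of axisymmetric solutions alone**
(Aretakis, JFA 263 (2012), §15: Thm. 5 from §15.2.2 through Lemma 15.0.1 with `𝕊₂ ∋ Q, T²`).
Suppose that for every function `Φ : E4 → ℝ` which is `C^∞` at the points of an open
`U₀ ⊇ {r ≥ M} ∩ {t* ≥ 0}` of the extremal Kerr–Schild chart `Kerr.region M r₀` (`0 < r₀ < M`),
axisymmetric on `{r > 0}` (`Φ ∘ R_β = Φ` there), solves `□_{g_{M,M}} Φ = 0` on `U₀` as a chart function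
and has Cauchy data on `{t* = 0}` supported in a coordinate ball, the sphere integrals
`∫₀^{2π}∫₀^π sin θ Φ(p_τ(θ, φ))² dθ dφ` over the horizon spheres `S_τ` tend to `0` as `τ → ∞`
(the qualitative content of §15.2.2 of the source: `∫_{𝕊²} ψ² ≤ C E₁[ψ] τ⁻¹` on `𝓐 ∪ 𝓗⁺`). Then
`Aretakis2012_pointwiseDecay` holds. Proof: given `ψ` of the class of the fact, pass to the smooth
axisymmetric global representative `ψ₀ = 2πψ` near `{r ≥ M} ∩ {t* ≥ 0}` (`Kerr.rotAverage`); apply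
the hypothesis to `ψ₀`, to `TTψ₀` (`timeDeriv_in_class`) and to the radial Carter operator `𝓡ψ₀`
(`Kerr.radOpChart`: a solution by `Kerr.dalembertian_radOpChart_eq_zero` — "`Qψ` is also a solution"
— localised by `Kerr.radOpChart_localised`, axisymmetric by `Kerr.radOpChart_axialRotation`); by
`Δ̸ψ₀ = −𝓡ψ₀ − M² sin² θ TTψ₀` on `S_τ` (`Kerr.sphereIntegral_roundLap_sq_le`) the sphere
integrals of `(Δ̸ψ₀)²` tend to `0`, and `Kerr.horizon_decay_of_sphereDecay` (the spherical Sobolev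
step, `ExtremalHorizonSphereSobolev.lean`) gives `sup_{S_τ}|ψ₀| → 0`.
[cite: Aretakis2012, Thm. 5 (second clause), §15.2.2, Lemma 15.0.1 and §5.3] -/
theorem Aretakis2012_pointwiseDecay_of_sphereL2Decay
    (H : ∀ [Kerr.Facts] [Kerr.SliceFacts] (M : ℝ), 0 < M → ∀ r₀ ∈ Set.Ioo 0 M,
      ∀ (U₀ : Set (Kerr.region M r₀)) (Φ : E4 → ℝ), IsOpen U₀ →
        {x : Kerr.region M r₀ | Kerr.rPlus M M ≤ Kerr.radius M (x : E4) ∧ 0 ≤ (x : E4) 0} ⊆ U₀ →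
        (∀ x ∈ U₀, ContDiffAt ℝ ∞ Φ x) →
        (∀ x ∈ U₀, (Kerr.smoothMetric M M r₀).toPseudoRiemannianMetric.dalembertian
          (fun y : Kerr.region M r₀ ↦ Φ y) x = 0) →
        (∃ ρ : ℝ, ∀ x ∈ U₀, (x : E4) 0 = 0 → ρ < E4.spatialNorm (x : E4) →
          Φ x = 0 ∧ fderiv ℝ Φ x = 0) →
        (∀ (β : ℝ) (z : E4), 0 < Kerr.radius M z → Φ (E4.axialRotation β z) = Φ z) →
        ∀ ε : ℝ, 0 < ε → ∃ τ₁ : ℝ, ∀ τ : ℝ, τ₁ ≤ τ →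
          (∫ φ in (0 : ℝ)..2 * Real.pi, ∫ θ in (0 : ℝ)..Real.pi,
            Real.sin θ * Φ (Kerr.horizonPoint M τ θ φ) ^ 2) ≤ ε) :
    Aretakis2012_pointwiseDecay := by
  intro _ _ M hM r₀ hr₀ U ψ hU hKU hψ hsol hloc haxiψ ε hε
  obtain ⟨hr₀pos, hr₀M⟩ := hr₀
  obtain ⟨ρ, hρ⟩ := hloc
  have hπ := Real.pi_pos
  /- Step 1: the representative, the open set over `U`, the cutoff (as in
  `Aretakis2015.axisymmetricBlowup_of_decay`) -/
  set Ψ : E4 → ℝ := Function.extend Subtype.val ψ 0 with hΨdef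
  have hrep : ∀ y : Kerr.region M r₀, ψ y = Ψ y := Kerr.extend_apply_coe ψ
  set V : Set E4 := Subtype.val '' U with hVdef
  have hV : IsOpen V := (Kerr.region M r₀).isOpen.isOpenMap_subtype_val U hU
  have hΨV : ∀ x ∈ V, ContDiffAt ℝ ∞ Ψ x := by
    rintro x ⟨y, hyU, rfl⟩
    exact (OpensChart.contMDiffAt_iff y ψ Ψ hrep).mp (hψ.contMDiffAt (hU.mem_nhds hyU))
  set K' : Set E4 := {x : E4 | Kerr.rPlus M M ≤ Kerr.radius M x ∧ 0 ≤ x 0} with hK'def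
  have hK'c : IsClosed K' := Kerr.isClosed_horizonFutureSet M M
  have hK'reg : ∀ x ∈ K', x ∈ Kerr.region M r₀ := by
    intro x hx
    rw [Kerr.mem_region]
    have h1 : Kerr.rPlus M M ≤ Kerr.radius M x := hx.1
    rw [Kerr.rPlus_self] at h1
    exact max_lt (by linarith) (by linarith)
  have hK'V : K' ⊆ V := fun x hx ↦ ⟨⟨x, hK'reg x hx⟩, hKU hx, rfl⟩
  obtain ⟨χ, N, hχ, hN, hKN, hNV, hχ1, hχsupp⟩ := Kerr.exists_smooth_cutoff hK'c hV hK'V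
  set G : E4 → ℝ := fun z ↦ χ z * Ψ z with hGdef
  have hG : ContDiff ℝ ∞ G := Kerr.contDiff_cutoff_mul hχ hχsupp hΨV
  have hGN : EqOn G Ψ N := fun z hz ↦ by
    show χ z * Ψ z = Ψ z
    rw [hχ1 z hz, one_mul]
  have hNU : ∀ z ∈ N, ∃ hz : z ∈ Kerr.region M r₀, (⟨z, hz⟩ : Kerr.region M r₀) ∈ U := by
    intro z hz
    obtain ⟨y, hyU, hyz⟩ := hNV hz
    subst hyz
    exact ⟨y.2, hyU⟩
  set U₀ : Set (Kerr.region M r₀) := {x | ∀ α : ℝ, E4.axialRotation α x ∈ N} with hU₀def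
  have hU₀ : IsOpen U₀ :=
    (Kerr.isOpen_setOf_forall_axialRotation_mem hN).preimage continuous_subtype_val
  have hKU₀ : {x : Kerr.region M r₀ | Kerr.rPlus M M ≤ Kerr.radius M (x : E4) ∧ 0 ≤ (x : E4) 0} ⊆
      U₀ := by
    intro x hx α
    exact hKN (Kerr.axialRotation_mem_horizonFutureSet_iff.mpr hx)
  have hU₀N : ∀ x ∈ U₀, ∀ α, E4.axialRotation α (x : E4) ∈ N := fun x hx ↦ hx
  /- Step 2: the averaged solution `ψ₀` -/
  set Ψ₀ : E4 → ℝ := Kerr.rotAverage G with hΨ₀def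
  have hΨ₀ : ContDiff ℝ ∞ Ψ₀ := Kerr.contDiff_rotAverage hG
  have hsol₀ : ∀ x ∈ U₀, (Kerr.smoothMetric M M r₀).toPseudoRiemannianMetric.dalembertian
      (fun y : Kerr.region M r₀ ↦ Ψ₀ y) x = 0 :=
    fun x hx ↦ Kerr.dalembertian_rotAverage_eq_zero hU hψ hsol hG hN hNU hGN x (hU₀N x hx)
  have hloc₀ : ∀ x ∈ U₀, (x : E4) 0 = 0 → ρ < E4.spatialNorm (x : E4) →
      Ψ₀ x = 0 ∧ fderiv ℝ Ψ₀ x = 0 := by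
    intro x hx hx0 hxρ
    have hzero : ∀ α, Ψ (E4.axialRotation α x) = 0 ∧
        fderiv ℝ Ψ (E4.axialRotation α x) = 0 := by
      intro α
      obtain ⟨hz, hzU⟩ := hNU _ (hU₀N x hx α)
      have h := hρ ⟨_, hz⟩ hzU (by simp [hx0]) (by simpa [E4.spatialNorm_axialRotation] using hxρ)
      have hd : DifferentiableAt ℝ Ψ (E4.axialRotation α x) :=
        ((OpensChart.contMDiffAt_iff ⟨_, hz⟩ ψ Ψ hrep).mp
          (hψ.contMDiffAt (hU.mem_nhds hzU))).differentiableAt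
          (WithTop.coe_ne_zero.mpr ENat.top_ne_zero)
      refine ⟨by rw [← hrep ⟨_, hz⟩]; exact h.1, ?_⟩
      rw [← OpensChart.mfderiv_eq ⟨_, hz⟩ ψ Ψ hrep hd]
      exact h.2
    have hz1 : ∀ α, Ψ (E4.axialRotation α x) = 0 := fun α ↦ (hzero α).1
    have hz2 : ∀ α, fderiv ℝ Ψ (E4.axialRotation α x) = 0 := fun α ↦ (hzero α).2
    constructor
    · show Kerr.rotAverage G x = 0
      rw [Kerr.rotAverage_apply_of_forall_mem hGN (hU₀N x hx)]
      simp only [hz1, intervalIntegral.integral_zero]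
    · ext v
      rw [Kerr.fderiv_rotAverage_apply_of_forall_mem hG hN hGN (hU₀N x hx)]
      simp only [hz2, _root_.zero_apply, intervalIntegral.integral_zero]
  have haxi₀ : ∀ β (x : E4), Ψ₀ (E4.axialRotation β x) = Ψ₀ x := fun β x ↦
    Kerr.rotAverage_axialRotation G β x
  /- Step 3: the three solutions `ψ₀`, `TTψ₀`, `𝓡ψ₀` and the hypothesis -/
  -- `ψ₀`
  have h0 := H M hM r₀ ⟨hr₀pos, hr₀M⟩ U₀ Ψ₀ hU₀ hKU₀ (fun x _ ↦ hΨ₀.contDiffAt) hsol₀ ⟨ρ, hloc₀⟩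
    (fun β z _ ↦ haxi₀ β z)
  -- `TTψ₀`
  obtain ⟨hT, hsolT, hlocT, haxiT⟩ := Kerr.timeDeriv_in_class hM.le hΨ₀ hU₀ hsol₀ hloc₀ haxi₀
  obtain ⟨hTT, hsolTT, hlocTT, haxiTT⟩ := Kerr.timeDeriv_in_class hM.le hT hU₀ hsolT hlocT haxiT
  have hTTs : ContDiff ℝ ∞ (Kerr.tDeriv (Kerr.tDeriv Ψ₀)) := hTT
  have hsolTT' : ∀ x ∈ U₀, (Kerr.smoothMetric M M r₀).toPseudoRiemannianMetric.dalembertian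
      (fun y : Kerr.region M r₀ ↦ Kerr.tDeriv (Kerr.tDeriv Ψ₀) y) x = 0 := hsolTT
  have hlocTT' : ∀ x ∈ U₀, (x : E4) 0 = 0 → ρ < E4.spatialNorm (x : E4) →
      Kerr.tDeriv (Kerr.tDeriv Ψ₀) x = 0 ∧ fderiv ℝ (Kerr.tDeriv (Kerr.tDeriv Ψ₀)) x = 0 := hlocTT
  have haxiTT' : ∀ β (z : E4), 0 < Kerr.radius M z →
      Kerr.tDeriv (Kerr.tDeriv Ψ₀) (E4.axialRotation β z) = Kerr.tDeriv (Kerr.tDeriv Ψ₀) z :=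
    fun β z _ ↦ haxiTT β z
  have hTT' := H M hM r₀ ⟨hr₀pos, hr₀M⟩ U₀ (Kerr.tDeriv (Kerr.tDeriv Ψ₀)) hU₀ hKU₀
    (fun x _ ↦ hTTs.contDiffAt) hsolTT' ⟨ρ, hlocTT'⟩ haxiTT'
  -- `𝓡ψ₀`
  have haxi₀' : ∀ β z, 0 < Kerr.radius M z → Ψ₀ (E4.axialRotation β z) = Ψ₀ z := fun β z _ ↦ haxi₀ β z
  have hΨ₀' : ∀ x ∈ U₀, ContDiffAt ℝ ∞ Ψ₀ x := fun x _ ↦ hΨ₀.contDiffAt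
  have hRsmooth : ∀ x ∈ U₀, ContDiffAt ℝ ∞ (Kerr.radOpChart M M Ψ₀) x := fun x _ ↦
    Kerr.contDiffAt_radOpChart M (Kerr.radius_pos_of_mem_region x.2) hΨ₀.contDiffAt
  have hRsol : ∀ x ∈ U₀, (Kerr.smoothMetric M M r₀).toPseudoRiemannianMetric.dalembertian
      (fun y : Kerr.region M r₀ ↦ Kerr.radOpChart M M Ψ₀ y) x = 0 := fun x hx ↦
    Kerr.dalembertian_radOpChart_eq_zero hM ⟨hr₀pos, hr₀M⟩ hU₀ hΨ₀' haxi₀' hsol₀ x hx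
  have hRloc : ∃ ρ' : ℝ, ∀ x ∈ U₀, (x : E4) 0 = 0 → ρ' < E4.spatialNorm (x : E4) →
      Kerr.radOpChart M M Ψ₀ x = 0 ∧ fderiv ℝ (Kerr.radOpChart M M Ψ₀) x = 0 :=
    ⟨ρ, fun x hx hx0 hxρ ↦ Kerr.radOpChart_localised hM.le hΨ₀ hU₀ hsol₀ hloc₀ x hx hx0 hxρ⟩
  have hRaxi : ∀ β z, 0 < Kerr.radius M z →
      Kerr.radOpChart M M Ψ₀ (E4.axialRotation β z) = Kerr.radOpChart M M Ψ₀ z := fun β z hz ↦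
    Kerr.radOpChart_axialRotation M haxi₀' (fun w _ ↦ hΨ₀.contDiffAt) β hz
  have hR' := H M hM r₀ ⟨hr₀pos, hr₀M⟩ U₀ (Kerr.radOpChart M M Ψ₀) hU₀ hKU₀ hRsmooth hRsol hRloc hRaxi
  /- Step 4: decay of the sphere integrals of `(Δ̸ψ₀)²`, then pointwise decay -/
  have hσU : ∀ σ : ℝ, 0 ≤ σ → ∀ θ φ, Kerr.horizonPoint M σ θ φ ∈ Subtype.val '' U₀ := by
    intro σ hσ θ φ
    have hp : Kerr.horizonPoint M σ θ φ ∈ Kerr.region M r₀ := Kerr.horizonPoint_mem_region hM hr₀M σ θ φ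
    refine ⟨⟨_, hp⟩, hKU₀ ⟨?_, ?_⟩, rfl⟩
    · show Kerr.rPlus M M ≤ Kerr.radius M (Kerr.horizonPoint M σ θ φ)
      rw [Kerr.rPlus_self, Kerr.radius_horizonPoint hM.le]
    · show 0 ≤ Kerr.horizonPoint M σ θ φ 0
      rwa [Kerr.horizonPoint_apply_zero]
  have h2 : ∀ ε' : ℝ, 0 < ε' → ∃ τ₁ : ℝ, ∀ σ : ℝ, τ₁ ≤ σ →
      (∫ φ in (0 : ℝ)..2 * Real.pi, ∫ θ in (0 : ℝ)..Real.pi,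
        Real.sin θ * Kerr.roundLap M Ψ₀ σ θ φ ^ 2) ≤ ε' := by
    intro ε' hε'
    obtain ⟨τa, hτa⟩ := hR' (ε' / 4) (by positivity)
    obtain ⟨τb, hτb⟩ := hTT' (ε' / (4 * (M ^ 4 + 1))) (by positivity)
    refine ⟨max (max τa τb) 0, fun σ hσ ↦ ?_⟩
    have hσ0 : 0 ≤ σ := (le_max_right _ _).trans hσ
    have ha := hτa σ ((le_max_left _ _).trans ((le_max_left _ _).trans hσ))
    have hb := hτb σ ((le_max_right _ _).trans ((le_max_left _ _).trans hσ))
    have hle := Kerr.sphereIntegral_roundLap_sq_le hM hU₀ hΨ₀ haxi₀ hsol₀ (hσU σ hσ0)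
    have hM4 : 0 ≤ M ^ 4 := by positivity
    have hb' : 2 * M ^ 4 * (∫ φ in (0 : ℝ)..2 * Real.pi, ∫ θ in (0 : ℝ)..Real.pi,
        Real.sin θ * Kerr.tDeriv (Kerr.tDeriv Ψ₀) (Kerr.horizonPoint M σ θ φ) ^ 2) ≤ ε' / 2 := by
      have h1 : 2 * M ^ 4 * (ε' / (4 * (M ^ 4 + 1))) ≤ ε' / 2 := by
        have hfrac : M ^ 4 / (M ^ 4 + 1) ≤ 1 := by
          rw [div_le_one (by positivity)]; linarith
        calc 2 * M ^ 4 * (ε' / (4 * (M ^ 4 + 1))) = (M ^ 4 / (M ^ 4 + 1)) * (ε' / 2) := by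
              field_simp
              ring
          _ ≤ 1 * (ε' / 2) := mul_le_mul_of_nonneg_right hfrac (by positivity)
          _ = ε' / 2 := one_mul _
      exact (mul_le_mul_of_nonneg_left hb (by positivity)).trans h1
    linarith
  have hΨ₀2 : ContDiff ℝ 2 Ψ₀ := hΨ₀.of_le (WithTop.coe_le_coe.mpr le_top)
  obtain ⟨τ₁, hτ₁⟩ := Kerr.horizon_decay_of_sphereDecay hΨ₀2 haxi₀ h0 h2 (2 * Real.pi * ε)
    (by positivity)
  refine ⟨max τ₁ 0, fun τ hτ x hxS ↦ ?_⟩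
  have hτ0 : 0 ≤ τ := (le_max_right _ _).trans hτ
  obtain ⟨θ, hθ, φ, hxe⟩ := Kerr.exists_horizonPoint_eq hM hxS
  /- Step 5: `ψ₀ = 2π ψ` at the points of `S_τ ⊆ K` -/
  have hxK : (x : E4) ∈ K' := by
    rw [Kerr.mem_horizonSection] at hxS
    exact ⟨hxS.1.ge, by rw [hxS.2]; exact hτ0⟩
  have horb : ∀ α, E4.axialRotation α (x : E4) ∈ N := fun α ↦
    hKN (Kerr.axialRotation_mem_horizonFutureSet_iff.mpr hxK)
  have hval : Ψ₀ x = 2 * Real.pi * ψ x := by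
    show Kerr.rotAverage G x = _
    rw [Kerr.rotAverage_apply_of_forall_mem hGN horb]
    have h : ∀ α, Ψ (E4.axialRotation α x) = ψ x := fun α ↦ by
      rw [← Kerr.coe_axialRotate M r₀ α x, ← hrep, haxiψ α x]
    simp only [h, intervalIntegral.integral_const, smul_eq_mul, sub_zero]
  have hb := hτ₁ τ ((le_max_left _ _).trans hτ) θ hθ φ
  rw [← hxe, hval, abs_mul, abs_of_pos (by positivity : (0 : ℝ) < 2 * Real.pi)] at hb
  exact le_of_mul_le_mul_left hb (by positivity)

end Literature.Barriers.FinalStateConjecture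

end
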